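import Mathlib
import HarnessLib
import Literature.NumberTheory.LFunctions.RobertSargosLatticeCount
import Literature.NumberTheory.Sieve.DivisorBound

/-!
# The Diophantine problem of Robert–Sargos (Compositio 2002, §3): Theorem 2 via Lemmas 6–7 — PROVED

Topic `Literature/NumberTheory/LFunctions`. Everything in this file is PROVED (no `sorry`, no named
facts). It formalizes §3 "The Diophantine problem" of O. Robert, P. Sargos, *A fourth derivative test
for exponential sums*, Compositio Math. 130 (2002) 275–292 (= arXiv:2307.03562v1, read in full): the
count behind the second spacing problem of their fourth-derivative test (Theorem 1 there = the tree's
named fact `Literature.NumberTheory.LFunctions.Sargos2003_lemma4`, file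
`RobertSargosFourthDerivative.lean`), namely

> **Theorem 2.** Let `R, H, Q, N ≥ 1` be real with `R ≤ H/2` and `δ > 0`; let `𝒩(R,Q,H,N,δ)` be the
> number of `(r, q₁, q₂, h₁, h₂, n₁, n₂) ∈ ℤ⁷` with `0 < |r| < R`, `Q ≤ |qᵢ| < 2Q`, `H ≤ hᵢ < 2H`,
> `1 ≤ nᵢ ≤ N`, `q₁q₂ > 0` (3·1) and `rn₁ + h₁q₁ = rn₂ + h₂q₂`,
> `|rn₁² + 2h₁q₁n₁ + h₁q₁² - (rn₂² + 2h₂q₂n₂ + h₂q₂²)| ≤ δHQ²` (3·2). Then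
> `𝒩(R,H,Q,N,δ) ≪_ε (RNHQ)^{1+ε}(1 + δQ)` (3·3).

(`Literature.NumberTheory.LFunctions.RobertSargos.theorem2`: for every `ε > 0` an explicit
`C = 43000 C_{ε/3} 4^{ε/3} (5 + 3/ε)²`, `C_η` the constant of the divisor bound `τ(n) ≤ C_η n^η` of
the tree's `Literature.NumberTheory.Sieve.exists_card_divisors_le_mul_rpow`, works for every finite
set of such septuples.) It is Step 7 of the printed proof of Theorem 1 (there with `δHQ² = 1/(Mλ)`,
giving `𝒩 ≪_ε M^ε λ^{-9/13}`, (4·26)).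

## The printed proof and this formalization

We follow §3.2–3.3 literally; counts are cardinalities of arbitrary finite sets of tuples
satisfying the constraints (`NCond`, `KCond`, `JCond`), so no enumeration of boxes is needed.

* **Lemma 6** (reduction). `n₁ = n₂ + d` maps `𝒩` onto sextuples satisfying (3·4) and (3·5) ⟺ (3·8)
  (`NCond.toKCond`, "the terms containing `n₂` cancel out"), at most `N` to one
  (`card_le_N_mul_card_image`); `|d| ≤ (δ+8)Q/2` (3·9) (`KCond.abs_d_le`). The sextuples with
  `d = 0` are `≤ 120 C_η(4HQ)^η RHQ` by `h₂q₂ = h₁q₁` and the divisor bound (`card_le_d_zero`);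
  those with `k = gcd(d,q₁,q₂) > Q` have `q₁ = q₂ = ±k` and are `≤ 1260 RHQ(1+δ)`
  (`card_le_gcd_large`, (3·11)); the others are divided by `j = gcd(r,h₁,h₂)`, `k` (`JCond_div`:
  "divide the first line of (3·5) by `jk` and the second by `jk²`") and land in `𝒥(R/j, Q/k, H/j, δ)`
  (`card_le_gcd_small`, summing Lemma 7 with `∑ 1/(j²k) ≤ 2(1 + log Q)`), giving (3·7); `lemma6`.
* **Lemma 7** (`𝒥(R,Q,H,δ) ≪_ε (RQH)^{1+ε}(1 + Qδ)`, `lemma7`, explicit: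
  `≤ 20800 C_η (4HQ)^η RHQ (1+Qδ)(1 + log(9Q/2))`). Case (a) `δ ≥ 1`: `h₂q₂ = h₁q₁ + rd` and the
  divisor bound (`card_le_a`). Case (b) (for `H ≤ Q`): fix `(r, h₁, h₂)`; by (3·13) the slopes
  `q₂/q₁` lie in an interval of length `8δ|r|/H` and **Lemma 5** (the tree's
  `RobertSargos.card_primitive_solutions_le`, file `RobertSargosLatticeCount.lean`) counts them:
  `≤ 45RH²(1 + 32δQ²/H)` (`card_fiber_b`, `card_le_b`, (3·14)). Case (c) (`δ < 1`, `Q < H`): by the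
  symmetry `(q₁,h₁) ↔ (q₂,h₂)`, `d ↦ -d` assume `d > 0`; fix `(d, q₁, q₂)`; the slopes `h₁/h₂` are
  within `δ` of `q₂(q₂-d)/(q₁(q₁+d))` (3·19) and within `Rd/(HQ)` of `q₂/q₁` (3·20), so Lemma 5 gives
  both `≤ 1 + 8δH²/d` and `≤ 1 + 8RH/Q` (`card_fiber_c₁`, `card_fiber_c₂`), while (3·21)
  `|q₂ - q₁ - 2d| ≤ 13Q(δ + Rd/(HQ))` (`abs_q₂_sub_le`) limits `q₂` given `(d, q₁)`; summing
  (`card_le_c_sum`, `sum_TC_le`) gives `≤ 5200 RHQ(1+Qδ)(1 + log(9Q/2))`. The printed proof splits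
  (c) into the regimes (3·15) `δ ≪ R/H` and (3·16) `δ ≫ R/H`; here both slope bounds are kept and
  the minimum is summed, which covers the two regimes at once.

All implied constants are explicit (and far from optimal); the `ε`-losses enter only through the
divisor bound and the harmonic sums `∑ 1/d`, `∑ 1/k` (`harmonic_Icc_le`).

## Main statements

* `RobertSargos.NCond`, `RobertSargos.KCond`, `RobertSargos.JCond` — the constraints (3·1)–(3·2),
  (3·4)+(3·8), and (3·4)–(3·6)+(3·8).
* `RobertSargos.lemma7` — [RS] Lemma 7, explicit form.
* `RobertSargos.lemma6` — [RS] Lemma 6 with Lemma 7 inserted, explicit form.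
* `RobertSargos.theorem2` — [RS] Theorem 2.

## References

* O. Robert, P. Sargos, *A fourth derivative test for exponential sums*, Compositio Math. 130 (2002),
  275–292, doi:10.1023/A:1014363224308 = arXiv:2307.03562v1 — §3: Theorem 2, Lemmas 5, 6, 7,
  formulas (3·1)–(3·21). [RobertSargos2002]
* G. H. Hardy, E. M. Wright, *An Introduction to the Theory of Numbers*, Thm 315 (the divisor bound,
  via the tree's `Sieve/DivisorBound.lean`).
-/

noncomputable section

namespace Literature.NumberTheory.LFunctions
namespace RobertSargos

open Finset

/-! ### The constraints of `𝒥(R, Q, H, δ)` ((3·4)–(3·6), with (3·5) in the equivalent form (3·8)) -/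

/-- The box (3·4) and the system (3·8) of [RS] §3.2 on a sextuple `(r, q₁, q₂, h₁, h₂, d) ∈ ℤ⁶`
(`0 < |r| < R`, `Q ≤ |qᵢ| < 2Q`, `H ≤ hᵢ < 2H`, `q₁q₂ > 0`; `rd + h₁q₁ - h₂q₂ = 0`,
`|(h₁q₁ + h₂q₂)d + h₁q₁² - h₂q₂²| ≤ δHQ²`), `d` unrestricted: the image of the septuples of
`𝒩(R,Q,H,N,δ)` under `d = n₁ - n₂` (Lemma 6). [cite: RobertSargos2002, (3.4), (3.5), (3.8)] -/
structure KCond (R Q H δ : ℝ) (r q₁ q₂ h₁ h₂ d : ℤ) : Prop where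
  r_ne : r ≠ 0
  r_lt : (|r| : ℝ) < R
  q₁_ge : Q ≤ (|q₁| : ℝ)
  q₁_lt : (|q₁| : ℝ) < 2 * Q
  q₂_ge : Q ≤ (|q₂| : ℝ)
  q₂_lt : (|q₂| : ℝ) < 2 * Q
  qq : 0 < q₁ * q₂
  h₁_ge : H ≤ (h₁ : ℝ)
  h₁_lt : (h₁ : ℝ) < 2 * H
  h₂_ge : H ≤ (h₂ : ℝ)
  h₂_lt : (h₂ : ℝ) < 2 * H
  lin : r * d + h₁ * q₁ - h₂ * q₂ = 0
  quad : (|((h₁ * q₁ + h₂ * q₂) * d + h₁ * q₁ ^ 2 - h₂ * q₂ ^ 2 : ℤ)| : ℝ) ≤ δ * H * Q ^ 2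

/-- The conditions defining the count `𝒥(R,Q,H,δ)` of [RS] §3.2 on a sextuple
`(r, q₁, q₂, h₁, h₂, d) ∈ ℤ⁶`: the box (3·4) and the system (3·8) (`KCond`), `d ≠ 0`, and the
coprimality conditions (3·6). The printed extra bound `|d| ≪ (1+δ)Q` of (3·4) is a consequence
(`KCond.abs_d_le`). [cite: RobertSargos2002, (3.4)-(3.6), (3.8)] -/
structure JCond (R Q H δ : ℝ) (r q₁ q₂ h₁ h₂ d : ℤ) : Prop
    extends KCond R Q H δ r q₁ q₂ h₁ h₂ d where
  d_ne : d ≠ 0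
  gcd_dq : Int.gcd (Int.gcd d q₁) q₂ = 1
  gcd_rh : Int.gcd (Int.gcd r h₁) h₂ = 1

/-! ### Small `gcd` symmetries -/

/-- `gcd(gcd(a,b),c) = gcd(gcd(c,b),a)`. [folklore] -/
theorem gcd3_comm13 (a b c : ℤ) : Int.gcd (Int.gcd a b) c = Int.gcd (Int.gcd c b) a := by
  rw [Int.gcd_assoc, Int.gcd_comm a, Int.gcd_comm b c]

/-- `gcd(gcd(a,b),c) = gcd(gcd(b,a),c)`. [folklore] -/
theorem gcd3_comm12 (a b c : ℤ) : Int.gcd (Int.gcd a b) c = Int.gcd (Int.gcd b a) c := by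
  rw [Int.gcd_comm a b]

/-- `gcd(gcd(a,b),c) = gcd(gcd(a,c),b)`. [folklore] -/
theorem gcd3_comm23 (a b c : ℤ) : Int.gcd (Int.gcd a b) c = Int.gcd (Int.gcd a c) b := by
  rw [Int.gcd_assoc, Int.gcd_comm b c, ← Int.gcd_assoc]

/-- `gcd(gcd(-a,-b),-c) = gcd(gcd(a,b),c)`. [folklore] -/
theorem gcd3_neg (a b c : ℤ) : Int.gcd (Int.gcd (-a) (-b)) (-c) = Int.gcd (Int.gcd a b) c := by
  rw [Int.neg_gcd, Int.gcd_neg, Int.gcd_neg]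

/-! ### Elementary consequences of the constraints -/

namespace KCond

variable {R Q H δ : ℝ} {r q₁ q₂ h₁ h₂ d : ℤ}

/-- `H > 0` (since `2R ≤ H`, `R ≥ 1` are the standing hypotheses we only need `|r| < R ≤ H/2`). [folklore] -/
theorem pos_H (hc : KCond R Q H δ r q₁ q₂ h₁ h₂ d) (hRH : 2 * R ≤ H) : 0 < H := by
  have := hc.r_lt
  linarith [abs_nonneg (r : ℝ)]

/-- `hᵢ > 0`. [folklore] -/
theorem h₁_pos (hc : KCond R Q H δ r q₁ q₂ h₁ h₂ d) (hRH : 2 * R ≤ H) : 0 < h₁ := by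
  have := hc.pos_H hRH
  have h := hc.h₁_ge
  exact_mod_cast this.trans_le h

/-- `hᵢ > 0`. [folklore] -/
theorem h₂_pos (hc : KCond R Q H δ r q₁ q₂ h₁ h₂ d) (hRH : 2 * R ≤ H) : 0 < h₂ := by
  have := hc.pos_H hRH
  have h := hc.h₂_ge
  exact_mod_cast this.trans_le h

/-- `(r : ℝ) < R` and `-R < r`. [folklore] -/
theorem r_lt' (hc : KCond R Q H δ r q₁ q₂ h₁ h₂ d) : (r : ℝ) < R ∧ -R < (r : ℝ) := by
  have := hc.r_lt
  exact ⟨(le_abs_self _).trans_lt this, by linarith [neg_abs_le (r : ℝ)]⟩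

/-- `hᵢ - r ≥ H/2` (as `2R ≤ H`). [folklore] -/
theorem h₂_sub_r_ge (hc : KCond R Q H δ r q₁ q₂ h₁ h₂ d) (hRH : 2 * R ≤ H) :
    H / 2 ≤ (h₂ : ℝ) - r := by
  have := hc.r_lt'.1; have := hc.h₂_ge; linarith

/-- `hᵢ - r ≥ H/2`. [folklore] -/
theorem h₁_sub_r_ge (hc : KCond R Q H δ r q₁ q₂ h₁ h₂ d) (hRH : 2 * R ≤ H) :
    H / 2 ≤ (h₁ : ℝ) - r := by
  have := hc.r_lt'.1; have := hc.h₁_ge; linarith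

/-- `Q > 0` as soon as `0 < q₁` (we always have `Q ≤ |q₁| < 2Q`). [folklore] -/
theorem pos_Q (hc : KCond R Q H δ r q₁ q₂ h₁ h₂ d) : 0 < Q := by
  have h1 := hc.q₁_ge; have h2 := hc.q₁_lt; linarith [abs_nonneg (q₁ : ℤ)]

/-- If `q₁ > 0` then `q₂ > 0`. [folklore] -/
theorem q₂_pos (hc : KCond R Q H δ r q₁ q₂ h₁ h₂ d) (hq : 0 < q₁) : 0 < q₂ := by
  have h := hc.qq
  rcases lt_trichotomy q₂ 0 with h' | h' | h'
  · nlinarith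
  · rw [h', mul_zero] at h; exact absurd h (lt_irrefl 0)
  · exact h'

/-- The sextuple with `(q₁, q₂, d)` negated satisfies the same constraints. [folklore] -/
theorem neg (hc : KCond R Q H δ r q₁ q₂ h₁ h₂ d) : KCond R Q H δ r (-q₁) (-q₂) h₁ h₂ (-d) where
  r_ne := hc.r_ne
  r_lt := hc.r_lt
  q₁_ge := by push_cast; rw [abs_neg]; exact hc.q₁_ge
  q₁_lt := by push_cast; rw [abs_neg]; exact hc.q₁_lt
  q₂_ge := by push_cast; rw [abs_neg]; exact hc.q₂_ge
  q₂_lt := by push_cast; rw [abs_neg]; exact hc.q₂_lt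
  qq := by rw [neg_mul_neg]; exact hc.qq
  h₁_ge := hc.h₁_ge
  h₁_lt := hc.h₁_lt
  h₂_ge := hc.h₂_ge
  h₂_lt := hc.h₂_lt
  lin := by have := hc.lin; linear_combination -this
  quad := by
    have := hc.quad
    push_cast at this ⊢
    convert this using 2
    ring

/-- The sextuple with the indices `1 ↔ 2` swapped and `d` negated satisfies the same constraints.
[folklore] -/
theorem swap (hc : KCond R Q H δ r q₁ q₂ h₁ h₂ d) : KCond R Q H δ r q₂ q₁ h₂ h₁ (-d) where
  r_ne := hc.r_ne
  r_lt := hc.r_lt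
  q₁_ge := hc.q₂_ge
  q₁_lt := hc.q₂_lt
  q₂_ge := hc.q₁_ge
  q₂_lt := hc.q₁_lt
  qq := by rw [mul_comm]; exact hc.qq
  h₁_ge := hc.h₂_ge
  h₁_lt := hc.h₂_lt
  h₂_ge := hc.h₁_ge
  h₂_lt := hc.h₁_lt
  lin := by have := hc.lin; linear_combination -this
  quad := by
    have := hc.quad
    push_cast at this ⊢
    rw [← abs_neg]
    convert this using 2
    ring

/-- **(3·9)**: `|d| ≤ (δ + 8)Q/2`, for `q₁ > 0`. From the second line of (3·8):
`(h₁q₁ + h₂q₂)|d| ≤ δHQ² + |h₁q₁² - h₂q₂²| < δHQ² + 8HQ²` and `h₁q₁ + h₂q₂ ≥ 2HQ`.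
[cite: RobertSargos2002, (3.9)] -/
theorem abs_d_le (hc : KCond R Q H δ r q₁ q₂ h₁ h₂ d) (hRH : 2 * R ≤ H) (hq : 0 < q₁) :
    (|d| : ℝ) ≤ (δ + 8) * Q / 2 := by
  have hq₂ := hc.q₂_pos hq
  have hH := hc.pos_H hRH
  have hQ := hc.pos_Q
  have hh₁ := hc.h₁_pos hRH
  have hh₂ := hc.h₂_pos hRH
  have hq1R : (Q : ℝ) ≤ q₁ := by have := hc.q₁_ge; rwa [abs_of_pos (by exact_mod_cast hq)] at this
  have hq1R' : (q₁ : ℝ) < 2 * Q := by have := hc.q₁_lt; rwa [abs_of_pos (by exact_mod_cast hq)] at this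
  have hq2R : (Q : ℝ) ≤ q₂ := by have := hc.q₂_ge; rwa [abs_of_pos (by exact_mod_cast hq₂)] at this
  have hq2R' : (q₂ : ℝ) < 2 * Q := by have := hc.q₂_lt; rwa [abs_of_pos (by exact_mod_cast hq₂)] at this
  have hh1R : (H : ℝ) ≤ h₁ := hc.h₁_ge
  have hh1R' : (h₁ : ℝ) < 2 * H := hc.h₁_lt
  have hh2R : (H : ℝ) ≤ h₂ := hc.h₂_ge
  have hh2R' : (h₂ : ℝ) < 2 * H := hc.h₂_lt
  have hquad := hc.quad
  push_cast at hquad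
  -- `S := h₁q₁ + h₂q₂ ≥ 2HQ > 0`
  have hS : 2 * H * Q ≤ (h₁ : ℝ) * q₁ + h₂ * q₂ := by nlinarith
  have hS0 : 0 < (h₁ : ℝ) * q₁ + h₂ * q₂ := by nlinarith
  -- `|h₁q₁² - h₂q₂²| < 8HQ²`
  have hT : |(h₁ : ℝ) * q₁ ^ 2 - h₂ * q₂ ^ 2| < 8 * H * Q ^ 2 := by
    rw [abs_lt]
    constructor
    · have : (h₂ : ℝ) * q₂ ^ 2 < 2 * H * (2 * Q) ^ 2 := by
        have h1 : (q₂ : ℝ) ^ 2 < (2 * Q) ^ 2 := by nlinarith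
        nlinarith
      nlinarith [sq_nonneg (q₁ : ℝ)]
    · have : (h₁ : ℝ) * q₁ ^ 2 < 2 * H * (2 * Q) ^ 2 := by
        have h1 : (q₁ : ℝ) ^ 2 < (2 * Q) ^ 2 := by nlinarith
        nlinarith
      nlinarith [sq_nonneg (q₂ : ℝ)]
  -- `S |d| ≤ δHQ² + 8HQ²`
  have hmain : ((h₁ : ℝ) * q₁ + h₂ * q₂) * |(d : ℝ)| ≤ δ * H * Q ^ 2 + 8 * H * Q ^ 2 := by
    have h1 : ((h₁ : ℝ) * q₁ + h₂ * q₂) * |(d : ℝ)| = |((h₁ : ℝ) * q₁ + h₂ * q₂) * d| := by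
      rw [abs_mul, abs_of_pos hS0]
    rw [h1]
    have h2 : ((h₁ : ℝ) * q₁ + h₂ * q₂) * d =
        ((h₁ * q₁ + h₂ * q₂) * d + h₁ * q₁ ^ 2 - h₂ * q₂ ^ 2) - (h₁ * q₁ ^ 2 - h₂ * q₂ ^ 2) := by ring
    rw [h2]
    refine (abs_sub _ _).trans ?_
    linarith
  rw [le_div_iff₀ (by norm_num : (0 : ℝ) < 2)]
  have h3 : 2 * H * Q * |(d : ℝ)| ≤ (δ + 8) * H * Q ^ 2 := by
    calc 2 * H * Q * |(d : ℝ)| ≤ ((h₁ : ℝ) * q₁ + h₂ * q₂) * |(d : ℝ)| :=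
          mul_le_mul_of_nonneg_right hS (abs_nonneg _)
      _ ≤ δ * H * Q ^ 2 + 8 * H * Q ^ 2 := hmain
      _ = (δ + 8) * H * Q ^ 2 := by ring
  have hHQ : 0 < H * Q := mul_pos hH hQ
  have h4 : H * Q * (2 * |(d : ℝ)|) ≤ H * Q * ((δ + 8) * Q) := by nlinarith
  have := le_of_mul_le_mul_left h4 hHQ
  linarith

end KCond

namespace JCond

variable {R Q H δ : ℝ} {r q₁ q₂ h₁ h₂ d : ℤ}

/-- The sextuple with `(q₁, q₂, d)` negated satisfies the same constraints. [folklore] -/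
theorem neg (hc : JCond R Q H δ r q₁ q₂ h₁ h₂ d) : JCond R Q H δ r (-q₁) (-q₂) h₁ h₂ (-d) where
  toKCond := hc.toKCond.neg
  d_ne := neg_ne_zero.mpr hc.d_ne
  gcd_dq := by rw [gcd3_neg]; exact hc.gcd_dq
  gcd_rh := hc.gcd_rh

/-- The sextuple with the indices `1 ↔ 2` swapped and `d` negated satisfies the same constraints.
[folklore] -/
theorem swap (hc : JCond R Q H δ r q₁ q₂ h₁ h₂ d) : JCond R Q H δ r q₂ q₁ h₂ h₁ (-d) where
  toKCond := hc.toKCond.swap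
  d_ne := neg_ne_zero.mpr hc.d_ne
  gcd_dq := by rw [Int.neg_gcd, gcd3_comm23]; exact hc.gcd_dq
  gcd_rh := by rw [gcd3_comm23]; exact hc.gcd_rh

end JCond


/-! ### Counting integers in a real interval -/

/-- A finite set of integers contained in a real interval of length `L ≥ 0` has at most `L + 1`
elements. [folklore] -/
theorem card_le_of_forall_mem_Icc (T : Finset ℤ) {x L : ℝ} (hL : 0 ≤ L)
    (hT : ∀ t ∈ T, x ≤ (t : ℝ) ∧ (t : ℝ) ≤ x + L) : (T.card : ℝ) ≤ L + 1 := by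
  have hsub : T ⊆ Finset.Icc ⌈x⌉ ⌊x + L⌋ := by
    intro t ht
    rw [Finset.mem_Icc]
    exact ⟨Int.ceil_le.mpr (hT t ht).1, Int.le_floor.mpr (hT t ht).2⟩
  have h1 : T.card ≤ (Finset.Icc ⌈x⌉ ⌊x + L⌋).card := Finset.card_le_card hsub
  rw [Int.card_Icc] at h1
  have h2 : (T.card : ℝ) ≤ ((⌊x + L⌋ + 1 - ⌈x⌉).toNat : ℝ) := by exact_mod_cast h1
  refine h2.trans ?_
  rcases le_or_gt 0 (⌊x + L⌋ + 1 - ⌈x⌉) with h | h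
  · have : (((⌊x + L⌋ + 1 - ⌈x⌉).toNat : ℤ) : ℝ) = ((⌊x + L⌋ + 1 - ⌈x⌉ : ℤ) : ℝ) := by
      rw [Int.toNat_of_nonneg h]
    rw [show ((⌊x + L⌋ + 1 - ⌈x⌉).toNat : ℝ) = (((⌊x + L⌋ + 1 - ⌈x⌉).toNat : ℤ) : ℝ) by norm_cast,
      this]
    push_cast
    have := Int.floor_le (x + L); have := Int.le_ceil x
    linarith
  · rw [Int.toNat_eq_zero.mpr h.le]; simp; linarith

/-! ### Fiberwise counting with a real bound -/

/-- If every fiber of `f : S → A` has at most `B` elements then `#S ≤ #A · B`. [folklore] -/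
theorem card_le_card_mul_of_fiber_le {α β : Type*} [DecidableEq β] (S : Finset α) (f : α → β)
    (A : Finset β) (hA : ∀ p ∈ S, f p ∈ A) {B : ℝ}
    (hB : ∀ a ∈ A, ((S.filter fun p => f p = a).card : ℝ) ≤ B) :
    (S.card : ℝ) ≤ A.card * B := by
  rw [Finset.card_eq_sum_card_fiberwise hA]
  push_cast
  calc ∑ a ∈ A, ((S.filter fun p => f p = a).card : ℝ) ≤ ∑ a ∈ A, B := Finset.sum_le_sum hB
    _ = A.card * B := by rw [Finset.sum_const, nsmul_eq_mul]

/-! ### Lemma 7, case (b): fixed `(r, h₁, h₂)`, counting `(q₂, q₁, d)` by Lemma 5 -/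

/-- **[RS] §3.3 (b).** Fix `r, h₁, h₂`. The triples `(q₂, q₁, d)` with `q₁ > 0` completing them to
a sextuple of `𝒥(R,Q,H,δ)` number at most `1 + 32 δ Q²/H`: by (3·13) their slopes `q₂/q₁` satisfy
`|(q₂/q₁)² - h₁(h₁-r)/(h₂(h₂-r))| ≤ 2δ|r|/H`, hence lie in an interval of length `8δ|r|/H`, and
Lemma 5 (`card_primitive_solutions_le`, with `c = r`, `V = Q`) applies.
[cite: RobertSargos2002, (3.13)-(3.14)] -/
theorem card_fiber_b {R Q H δ : ℝ} (hH : 0 < H) (hRH : 2 * R ≤ H) (hδ : 0 < δ) (r h₁ h₂ : ℤ)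
    (T : Finset (ℤ × ℤ × ℤ)) (hT : ∀ t ∈ T, JCond R Q H δ r t.2.1 t.1 h₁ h₂ t.2.2 ∧ 0 < t.2.1) :
    (T.card : ℝ) ≤ 1 + 32 * δ * Q ^ 2 / H := by
  classical
  rcases T.eq_empty_or_nonempty with hTe | ⟨t₀, ht₀⟩
  · rw [hTe, Finset.card_empty, Nat.cast_zero]; positivity
  obtain ⟨hc₀, hq₀⟩ := hT t₀ ht₀
  have hQ : 0 < Q := hc₀.pos_Q
  have hr : r ≠ 0 := hc₀.r_ne
  have hrR : (0 : ℝ) < |(r : ℝ)| := abs_pos.mpr (by exact_mod_cast hr)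
  set Θ : ℝ := (h₁ : ℝ) * (h₁ - r) / (h₂ * (h₂ - r)) with hΘ
  set η : ℝ := 2 * δ * |(r : ℝ)| / H with hη
  have hη0 : 0 ≤ η := by positivity
  -- the slope of every element is within `η` of `Θ` in square, and exceeds `1/2`
  have key : ∀ t ∈ T, |((t.1 : ℝ) / t.2.1) ^ 2 - Θ| ≤ η ∧ 1 / 2 < (t.1 : ℝ) / t.2.1 := by
    intro t ht
    obtain ⟨hc, hq⟩ := hT t ht
    have hq₂ := hc.q₂_pos hq
    have hq1R : (0 : ℝ) < t.2.1 := by exact_mod_cast hq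
    have hq2R : (0 : ℝ) < t.1 := by exact_mod_cast hq₂
    have hQq₁ : Q ≤ (t.2.1 : ℝ) := by
      have := hc.q₁_ge; rwa [abs_of_pos hq1R] at this
    have hq₁Q : (t.2.1 : ℝ) < 2 * Q := by
      have := hc.q₁_lt; rwa [abs_of_pos hq1R] at this
    have hQq₂ : Q ≤ (t.1 : ℝ) := by
      have := hc.q₂_ge; rwa [abs_of_pos hq2R] at this
    have hq₂Q : (t.1 : ℝ) < 2 * Q := by
      have := hc.q₂_lt; rwa [abs_of_pos hq2R] at this
    have hh₂ : (0 : ℝ) < h₂ := by exact_mod_cast hc.h₂_pos hRH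
    have hh₂r : H / 2 ≤ (h₂ : ℝ) - r := hc.h₂_sub_r_ge hRH
    have hh₂r0 : (0 : ℝ) < h₂ - r := by linarith
    have hHh₂ : H ≤ (h₂ : ℝ) := hc.h₂_ge
    constructor
    · -- `X := q₂² h₂ (h₂ - r) - q₁² h₁ (h₁ - r) = r · A`
      set A : ℝ := ((h₁ : ℝ) * t.2.1 + h₂ * t.1) * t.2.2 + h₁ * t.2.1 ^ 2 - h₂ * t.1 ^ 2 with hA
      have hAle : |A| ≤ δ * H * Q ^ 2 := by
        have := hc.quad; push_cast at this; rw [hA]; exact this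
      have hl : (r : ℝ) * t.2.2 = h₂ * t.1 - h₁ * t.2.1 := by
        have := hc.lin
        have h' : ((r * t.2.2 + h₁ * t.2.1 - h₂ * t.1 : ℤ) : ℝ) = 0 := by exact_mod_cast this
        push_cast at h'; linarith
      have hX : (t.1 : ℝ) ^ 2 * (h₂ * (h₂ - r)) - (t.2.1 : ℝ) ^ 2 * (h₁ * (h₁ - r)) = r * A := by
        rw [hA]; linear_combination -(((h₁ : ℝ) * t.2.1 + h₂ * t.1)) * hl
      have hq1ne : (t.2.1 : ℝ) ≠ 0 := hq1R.ne'
      have hdiff : ((t.1 : ℝ) / t.2.1) ^ 2 - Θ = r * A / ((t.2.1 : ℝ) ^ 2 * (h₂ * (h₂ - r))) := by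
        rw [hΘ, ← hX]
        field_simp
      rw [hdiff, abs_div, abs_mul, abs_of_pos (by positivity : (0 : ℝ) < (t.2.1 : ℝ) ^ 2 * (h₂ * (h₂ - r)))]
      rw [div_le_iff₀ (by positivity)]
      -- `|r| |A| ≤ |r| δ H Q² ≤ η · q₁² h₂ (h₂ - r)`
      have h1 : |(r : ℝ)| * |A| ≤ |(r : ℝ)| * (δ * H * Q ^ 2) := mul_le_mul_of_nonneg_left hAle (abs_nonneg _)
      refine h1.trans ?_
      rw [hη]
      have hQ2 : Q ^ 2 ≤ (t.2.1 : ℝ) ^ 2 := pow_le_pow_left₀ hQ.le hQq₁ 2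
      have h3 : H * (H / 2) ≤ (h₂ : ℝ) * (h₂ - r) := mul_le_mul hHh₂ hh₂r (by linarith) hh₂.le
      have h4 : Q ^ 2 * (H * (H / 2)) ≤ (t.2.1 : ℝ) ^ 2 * (h₂ * (h₂ - r)) :=
        mul_le_mul hQ2 h3 (by positivity) (by positivity)
      calc |(r : ℝ)| * (δ * H * Q ^ 2) = 2 * δ * |(r : ℝ)| / H * (Q ^ 2 * (H * (H / 2))) := by
            rw [div_mul_eq_mul_div, eq_div_iff hH.ne']; ring
        _ ≤ 2 * δ * |(r : ℝ)| / H * ((t.2.1 : ℝ) ^ 2 * (h₂ * (h₂ - r))) :=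
            mul_le_mul_of_nonneg_left h4 (by positivity)
    · rw [lt_div_iff₀ hq1R]; linarith
  -- hence all slopes are within `2η` of the slope of `t₀`
  set s₀ : ℝ := (t₀.1 : ℝ) / t₀.2.1 with hs₀
  have hslope : ∀ t ∈ T, s₀ - 2 * η ≤ (t.1 : ℝ) / t.2.1 ∧ (t.1 : ℝ) / t.2.1 ≤ s₀ + 2 * η := by
    intro t ht
    obtain ⟨k1, k2⟩ := key t ht
    obtain ⟨k1₀, k2₀⟩ := key t₀ ht₀
    set s : ℝ := (t.1 : ℝ) / t.2.1 with hs
    have hsum : 1 < s + s₀ := by rw [hs₀]; linarith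
    have hsq : |s ^ 2 - s₀ ^ 2| ≤ 2 * η := by
      calc |s ^ 2 - s₀ ^ 2| = |(s ^ 2 - Θ) - (s₀ ^ 2 - Θ)| := by ring_nf
        _ ≤ |s ^ 2 - Θ| + |s₀ ^ 2 - Θ| := abs_sub _ _
        _ ≤ 2 * η := by rw [hs₀]; linarith
    have hfac : s ^ 2 - s₀ ^ 2 = (s - s₀) * (s + s₀) := by ring
    have habs : |s - s₀| ≤ 2 * η := by
      have h1 : |s - s₀| * (s + s₀) = |s ^ 2 - s₀ ^ 2| := by
        rw [hfac, abs_mul, abs_of_pos (show (0 : ℝ) < s + s₀ by linarith)]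
      have h2 : |s - s₀| * 1 ≤ |s - s₀| * (s + s₀) :=
        mul_le_mul_of_nonneg_left hsum.le (abs_nonneg _)
      linarith
    constructor <;> linarith [abs_le.mp habs]
  -- Lemma 5 with `a = -h₂`, `b = h₁`, `c = r`, `V = Q`
  have hgcd : Int.gcd (Int.gcd (-h₂) h₁) r = 1 := by
    rw [Int.neg_gcd, gcd3_comm13]; exact hc₀.gcd_rh
  have hL5 := card_primitive_solutions_le (a := -h₂) (b := h₁) (c := r) hr hgcd hQ
    (α := s₀ - 2 * η) (β := s₀ + 2 * η) (by linarith) T (fun t ht => by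
      obtain ⟨hc, hq⟩ := hT t ht
      have hq1R : (0 : ℝ) < t.2.1 := by exact_mod_cast hq
      refine ⟨hc.d_ne, ?_, ?_, ?_, ?_, (hslope t ht).1, (hslope t ht).2⟩
      · rw [gcd3_comm13]; exact hc.gcd_dq
      · have := hc.q₁_ge; rwa [abs_of_pos hq1R] at this
      · have := hc.q₁_lt; rw [abs_of_pos hq1R] at this; exact this.le
      · have := hc.lin; linear_combination this)
  refine hL5.trans (le_of_eq ?_)
  rw [hη]
  field_simp
  try ring

/-- **[RS] (3·14).** The sextuples of `𝒥(R,Q,H,δ)` with `q₁ > 0` number at most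
`45 R H² (1 + 32 δ Q²/H)` (`R ≥ 1`, `H ≥ 2R`). [cite: RobertSargos2002, (3.14)] -/
theorem card_le_b {R Q H δ : ℝ} (hR : 1 ≤ R) (hRH : 2 * R ≤ H) (hδ : 0 < δ)
    (S : Finset (ℤ × ℤ × ℤ × ℤ × ℤ × ℤ))
    (hS : ∀ p ∈ S, JCond R Q H δ p.1 p.2.1 p.2.2.1 p.2.2.2.1 p.2.2.2.2.1 p.2.2.2.2.2 ∧ 0 < p.2.1) :
    (S.card : ℝ) ≤ 45 * R * H ^ 2 * (1 + 32 * δ * Q ^ 2 / H) := by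
  classical
  have hH : 0 < H := by linarith
  -- the finite range of `(r, h₁, h₂)`
  set A : Finset (ℤ × ℤ × ℤ) :=
    (Finset.Icc (-⌈R⌉) ⌈R⌉) ×ˢ ((Finset.Icc 0 ⌈2 * H⌉) ×ˢ (Finset.Icc 0 ⌈2 * H⌉)) with hAdef
  set f : ℤ × ℤ × ℤ × ℤ × ℤ × ℤ → ℤ × ℤ × ℤ := fun p => (p.1, p.2.2.2.1, p.2.2.2.2.1) with hf
  have hfA : ∀ p ∈ S, f p ∈ A := by
    intro p hp
    obtain ⟨hc, _⟩ := hS p hp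
    simp only [hf, hAdef, Finset.mem_product, Finset.mem_Icc]
    obtain ⟨h1, h2⟩ := hc.r_lt'
    have h3 := hc.h₁_ge; have h4 := hc.h₁_lt; have h5 := hc.h₂_ge; have h6 := hc.h₂_lt
    have hRc : R ≤ ⌈R⌉ := Int.le_ceil R
    have hHc : 2 * H ≤ ⌈2 * H⌉ := Int.le_ceil _
    refine ⟨⟨?_, ?_⟩, ⟨?_, ?_⟩, ⟨?_, ?_⟩⟩
    · have : (-⌈R⌉ : ℝ) ≤ p.1 := by linarith
      exact_mod_cast this
    · have : (p.1 : ℝ) ≤ ⌈R⌉ := by linarith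
      exact_mod_cast this
    · have : (0 : ℝ) ≤ p.2.2.2.1 := by linarith
      exact_mod_cast this
    · have : (p.2.2.2.1 : ℝ) ≤ ⌈2 * H⌉ := by linarith
      exact_mod_cast this
    · have : (0 : ℝ) ≤ p.2.2.2.2.1 := by linarith
      exact_mod_cast this
    · have : (p.2.2.2.2.1 : ℝ) ≤ ⌈2 * H⌉ := by linarith
      exact_mod_cast this
  have hAcard : (A.card : ℝ) ≤ 45 * R * H ^ 2 := by
    rw [hAdef, Finset.card_product, Finset.card_product, Int.card_Icc, Int.card_Icc]
    have h1 : ((⌈R⌉ + 1 - -⌈R⌉).toNat : ℝ) ≤ 2 * R + 3 := by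
      have h0 : (0 : ℤ) ≤ ⌈R⌉ + 1 - -⌈R⌉ := by have := Int.ceil_nonneg (by linarith : (0:ℝ) ≤ R); omega
      have : (((⌈R⌉ + 1 - -⌈R⌉).toNat : ℤ) : ℝ) = ((⌈R⌉ + 1 - -⌈R⌉ : ℤ) : ℝ) := by
        rw [Int.toNat_of_nonneg h0]
      rw [show ((⌈R⌉ + 1 - -⌈R⌉).toNat : ℝ) = (((⌈R⌉ + 1 - -⌈R⌉).toNat : ℤ) : ℝ) by norm_cast, this]
      push_cast
      have := Int.ceil_lt_add_one R; linarith
    have h2 : ((⌈2 * H⌉ + 1 - 0).toNat : ℝ) ≤ 2 * H + 2 := by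
      have h0 : (0 : ℤ) ≤ ⌈2 * H⌉ + 1 - 0 := by have := Int.ceil_nonneg (by linarith : (0:ℝ) ≤ 2 * H); omega
      have : (((⌈2 * H⌉ + 1 - 0).toNat : ℤ) : ℝ) = ((⌈2 * H⌉ + 1 - 0 : ℤ) : ℝ) := by
        rw [Int.toNat_of_nonneg h0]
      rw [show ((⌈2 * H⌉ + 1 - 0).toNat : ℝ) = (((⌈2 * H⌉ + 1 - 0).toNat : ℤ) : ℝ) by norm_cast, this]
      push_cast
      have := Int.ceil_lt_add_one (2 * H); linarith
    push_cast
    have h3 : 2 * R + 3 ≤ 5 * R := by linarith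
    have h4 : 2 * H + 2 ≤ 3 * H := by linarith
    calc ((⌈R⌉ + 1 - -⌈R⌉).toNat : ℝ) * (((⌈2 * H⌉ + 1 - 0).toNat : ℝ) * ((⌈2 * H⌉ + 1 - 0).toNat : ℝ))
        ≤ (5 * R) * ((3 * H) * (3 * H)) := by
          apply mul_le_mul (h1.trans h3) _ (by positivity) (by positivity)
          exact mul_le_mul (h2.trans h4) (h2.trans h4) (by positivity) (by positivity)
      _ = 45 * R * H ^ 2 := by ring
  -- each fiber injects into a set of triples `(q₂, q₁, d)` as in `card_fiber_b`
  have hfib : ∀ a ∈ A, ((S.filter fun p => f p = a).card : ℝ) ≤ 1 + 32 * δ * Q ^ 2 / H := by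
    intro a _
    set g : ℤ × ℤ × ℤ × ℤ × ℤ × ℤ → ℤ × ℤ × ℤ := fun p => (p.2.2.1, p.2.1, p.2.2.2.2.2) with hg
    have hinj : Set.InjOn g (S.filter fun p => f p = a) := by
      intro p hp p' hp' hpp
      simp only [Finset.coe_filter, Set.mem_setOf_eq] at hp hp'
      simp only [hg, hf, Prod.mk.injEq] at hpp hp hp'
      obtain ⟨_, hfp⟩ := hp
      obtain ⟨_, hfp'⟩ := hp'
      have hee := hfp.trans hfp'.symm
      simp only [Prod.mk.injEq] at hee
      obtain ⟨e1, e2, e3⟩ := hee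
      obtain ⟨e4, e5, e6⟩ := hpp
      exact Prod.ext e1 (Prod.ext e5 (Prod.ext e4 (Prod.ext e2 (Prod.ext e3 e6))))
    rw [← Finset.card_image_of_injOn hinj]
    refine card_fiber_b hH hRH hδ a.1 a.2.1 a.2.2 _ fun t ht => ?_
    simp only [Finset.mem_image, Finset.mem_filter] at ht
    obtain ⟨p, ⟨hp, hfp⟩, rfl⟩ := ht
    obtain ⟨hc, hq⟩ := hS p hp
    simp only [hf] at hfp
    subst hfp
    exact ⟨hc, hq⟩
  have h := card_le_card_mul_of_fiber_le S f A hfA hfib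
  refine h.trans ?_
  have : 0 ≤ 1 + 32 * δ * Q ^ 2 / H := by positivity
  exact mul_le_mul_of_nonneg_right hAcard this

/-! ### Lemma 7, case (c): fixed `(d, q₁, q₂)`, counting `(h₁, h₂, r)` by Lemma 5 -/

/-- **[RS] §3.3 (c), first slope bound (3·19).** Fix `d > 0`, `q₁ > 0`, `q₂`. The triples
`(h₁, h₂, r)` completing them to a sextuple of `𝒥(R,Q,H,δ)` have slopes `h₁/h₂` within `δ` of
`ρ = q₂(q₂-d)/(q₁(q₁+d))`, so by Lemma 5 (`c = d`, `V = H`) they number at most `1 + 8δH²/d`.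
[cite: RobertSargos2002, (3.17), (3.19)] -/
theorem card_fiber_c₁ {R Q H δ : ℝ} (hH : 0 < H) (hRH : 2 * R ≤ H) (hδ : 0 < δ) {d q₁ q₂ : ℤ}
    (hd : 0 < d) (hq : 0 < q₁) (U : Finset (ℤ × ℤ × ℤ))
    (hU : ∀ t ∈ U, JCond R Q H δ t.2.2 q₁ q₂ t.1 t.2.1 d) :
    (U.card : ℝ) ≤ 1 + 8 * δ * H ^ 2 / d := by
  classical
  rcases U.eq_empty_or_nonempty with hUe | ⟨t₀, ht₀⟩
  · rw [hUe, Finset.card_empty, Nat.cast_zero]; positivity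
  have hc₀ := hU t₀ ht₀
  have hQ : 0 < Q := hc₀.pos_Q
  have hq₂ : 0 < q₂ := hc₀.q₂_pos hq
  have hdR : (0 : ℝ) < d := by exact_mod_cast hd
  have hq1R : (0 : ℝ) < q₁ := by exact_mod_cast hq
  have hq2R : (0 : ℝ) < q₂ := by exact_mod_cast hq₂
  have hQq₁ : Q ≤ (q₁ : ℝ) := by have := hc₀.q₁_ge; rwa [abs_of_pos hq1R] at this
  set ρ : ℝ := (q₂ : ℝ) * (q₂ - d) / (q₁ * (q₁ + d)) with hρ
  have hslope : ∀ t ∈ U, ρ - δ ≤ (t.1 : ℝ) / t.2.1 ∧ (t.1 : ℝ) / t.2.1 ≤ ρ + δ := by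
    intro t ht
    have hc := hU t ht
    have hh₂ : (0 : ℝ) < t.2.1 := by exact_mod_cast hc.h₂_pos hRH
    have hHh₂ : H ≤ (t.2.1 : ℝ) := hc.h₂_ge
    set A : ℝ := ((t.1 : ℝ) * q₁ + t.2.1 * q₂) * d + t.1 * q₁ ^ 2 - t.2.1 * q₂ ^ 2 with hA
    have hAle : |A| ≤ δ * H * Q ^ 2 := by have := hc.quad; push_cast at this; rw [hA]; exact this
    have hden : (0 : ℝ) < t.2.1 * (q₁ * (q₁ + d)) := by positivity
    have hdiff : (t.1 : ℝ) / t.2.1 - ρ = A / (t.2.1 * (q₁ * (q₁ + d))) := by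
      rw [hρ, hA]
      field_simp
      ring
    have habs : |(t.1 : ℝ) / t.2.1 - ρ| ≤ δ := by
      rw [hdiff, abs_div, abs_of_pos hden, div_le_iff₀ hden]
      refine hAle.trans ?_
      -- `δ H Q² ≤ δ · h₂ · q₁ · (q₁ + d)`
      have h1 : Q ^ 2 ≤ (q₁ : ℝ) * (q₁ + d) := by nlinarith
      have h2 : H * Q ^ 2 ≤ (t.2.1 : ℝ) * (q₁ * (q₁ + d)) := mul_le_mul hHh₂ h1 (by positivity) hh₂.le
      calc δ * H * Q ^ 2 = δ * (H * Q ^ 2) := by ring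
        _ ≤ δ * ((t.2.1 : ℝ) * (q₁ * (q₁ + d))) := mul_le_mul_of_nonneg_left h2 hδ.le
    constructor <;> linarith [abs_le.mp habs]
  have hgcd : Int.gcd (Int.gcd q₁ (-q₂)) d = 1 := by
    rw [Int.gcd_neg, gcd3_comm13, gcd3_comm23]; exact hc₀.gcd_dq
  have hL5 := card_primitive_solutions_le (a := q₁) (b := -q₂) (c := d) hd.ne' hgcd hH
    (α := ρ - δ) (β := ρ + δ) (by linarith) U (fun t ht => by
      have hc := hU t ht
      refine ⟨hc.r_ne, ?_, hc.h₂_ge, hc.h₂_lt.le, ?_, (hslope t ht).1, (hslope t ht).2⟩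
      · rw [gcd3_comm13, gcd3_comm23]; exact hc.gcd_rh
      · have := hc.lin; linear_combination this)
  refine hL5.trans (le_of_eq ?_)
  rw [abs_of_pos hdR]
  ring

/-- **[RS] §3.3 (c), second slope bound (3·20).** Fix `d > 0`, `q₁ > 0`, `q₂`. The slopes `h₁/h₂`
of the triples `(h₁, h₂, r)` completing them are within `R d/(HQ)` of `q₂/q₁` (first line of
(3·8)), so by Lemma 5 they number at most `1 + 8RH/Q`. [cite: RobertSargos2002, (3.18), (3.20)] -/
theorem card_fiber_c₂ {R Q H δ : ℝ} (hR : 0 < R) (hQ : 0 < Q) (hH : 0 < H) (hRH : 2 * R ≤ H)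
    {d q₁ q₂ : ℤ} (hd : 0 < d) (hq : 0 < q₁) (U : Finset (ℤ × ℤ × ℤ))
    (hU : ∀ t ∈ U, JCond R Q H δ t.2.2 q₁ q₂ t.1 t.2.1 d) :
    (U.card : ℝ) ≤ 1 + 8 * R * H / Q := by
  classical
  rcases U.eq_empty_or_nonempty with hUe | ⟨t₀, ht₀⟩
  · rw [hUe, Finset.card_empty, Nat.cast_zero]; positivity
  have hc₀ := hU t₀ ht₀
  have hdR : (0 : ℝ) < d := by exact_mod_cast hd
  have hq1R : (0 : ℝ) < q₁ := by exact_mod_cast hq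
  have hQq₁ : Q ≤ (q₁ : ℝ) := by have := hc₀.q₁_ge; rwa [abs_of_pos hq1R] at this
  set σ : ℝ := (q₂ : ℝ) / q₁ with hσ
  set w : ℝ := R * d / (H * Q) with hw
  have hslope : ∀ t ∈ U, σ - w ≤ (t.1 : ℝ) / t.2.1 ∧ (t.1 : ℝ) / t.2.1 ≤ σ + w := by
    intro t ht
    have hc := hU t ht
    have hh₂ : (0 : ℝ) < t.2.1 := by exact_mod_cast hc.h₂_pos hRH
    have hHh₂ : H ≤ (t.2.1 : ℝ) := hc.h₂_ge
    have hl : (t.1 : ℝ) * q₁ - t.2.1 * q₂ = -(t.2.2 * d) := by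
      have := hc.lin
      have h' : ((t.2.2 * d + t.1 * q₁ - t.2.1 * q₂ : ℤ) : ℝ) = 0 := by exact_mod_cast this
      push_cast at h'; linarith
    have hdiff : (t.1 : ℝ) / t.2.1 - σ = -(t.2.2 * d) / (t.2.1 * q₁) := by
      rw [hσ, ← hl]; field_simp
    have hr : |(t.2.2 : ℝ)| ≤ R := by exact hc.r_lt.le
    have habs : |(t.1 : ℝ) / t.2.1 - σ| ≤ w := by
      rw [hdiff, abs_div, abs_neg, abs_mul, abs_of_pos hdR, abs_of_pos (mul_pos hh₂ hq1R), hw]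
      rw [div_le_div_iff₀ (mul_pos hh₂ hq1R) (by positivity)]
      have h1 : H * Q ≤ (t.2.1 : ℝ) * q₁ := mul_le_mul hHh₂ hQq₁ hQ.le hh₂.le
      calc |(t.2.2 : ℝ)| * d * (H * Q) ≤ R * d * (H * Q) := by gcongr
        _ ≤ R * d * ((t.2.1 : ℝ) * q₁) := by gcongr
    constructor <;> linarith [abs_le.mp habs]
  have hgcd : Int.gcd (Int.gcd q₁ (-q₂)) d = 1 := by
    rw [Int.gcd_neg, gcd3_comm13, gcd3_comm23]; exact hc₀.gcd_dq
  have hL5 := card_primitive_solutions_le (a := q₁) (b := -q₂) (c := d) hd.ne' hgcd hH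
    (α := σ - w) (β := σ + w) (by have : 0 ≤ w := by positivity
                                  linarith) U (fun t ht => by
      have hc := hU t ht
      refine ⟨hc.r_ne, ?_, hc.h₂_ge, hc.h₂_lt.le, ?_, (hslope t ht).1, (hslope t ht).2⟩
      · rw [gcd3_comm13, gcd3_comm23]; exact hc.gcd_rh
      · have := hc.lin; linear_combination this)
  refine hL5.trans (le_of_eq ?_)
  rw [abs_of_pos hdR, hw]
  field_simp
  try ring

/-- **[RS] (3·21).** For a sextuple of `𝒥(R,Q,H,δ)` with `q₁ > 0`, `d > 0` and `δ ≤ 1`: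
`|q₂ - q₁ - 2d| ≤ 13Q(δ + R d/(HQ))`, from the two slope approximations (3·19), (3·20) and
`ρ - q₂/q₁ = q₂(q₂ - q₁ - 2d)/(q₁(q₁ + d))`, `|d| ≤ 9Q/2`. [cite: RobertSargos2002, (3.21)] -/
theorem abs_q₂_sub_le {R Q H δ : ℝ} (hRH : 2 * R ≤ H) (hδ : 0 < δ) (hδ1 : δ ≤ 1)
    {r q₁ q₂ h₁ h₂ d : ℤ} (hc : JCond R Q H δ r q₁ q₂ h₁ h₂ d) (hq : 0 < q₁) (hd : 0 < d) :
    |(q₂ : ℝ) - q₁ - 2 * d| ≤ 13 * Q * δ + 13 * R * d / H := by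
  have hH := hc.pos_H hRH
  have hQ := hc.pos_Q
  have hq₂ := hc.q₂_pos hq
  have hdR : (0 : ℝ) < d := by exact_mod_cast hd
  have hq1R : (0 : ℝ) < q₁ := by exact_mod_cast hq
  have hq2R : (0 : ℝ) < q₂ := by exact_mod_cast hq₂
  have hQq₁ : Q ≤ (q₁ : ℝ) := by have := hc.q₁_ge; rwa [abs_of_pos hq1R] at this
  have hq₁Q : (q₁ : ℝ) < 2 * Q := by have := hc.q₁_lt; rwa [abs_of_pos hq1R] at this
  have hQq₂ : Q ≤ (q₂ : ℝ) := by have := hc.q₂_ge; rwa [abs_of_pos hq2R] at this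
  have hh₂ : (0 : ℝ) < h₂ := by exact_mod_cast hc.h₂_pos hRH
  have hHh₂ : H ≤ (h₂ : ℝ) := hc.h₂_ge
  have hdle : (d : ℝ) ≤ 9 * Q / 2 := by
    have := hc.abs_d_le hRH hq
    rw [abs_of_pos hdR] at this
    nlinarith
  -- (3·19): `|h₁/h₂ - ρ| ≤ δ`
  set ρ : ℝ := (q₂ : ℝ) * (q₂ - d) / (q₁ * (q₁ + d)) with hρ
  set A : ℝ := ((h₁ : ℝ) * q₁ + h₂ * q₂) * d + h₁ * q₁ ^ 2 - h₂ * q₂ ^ 2 with hA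
  have hAle : |A| ≤ δ * H * Q ^ 2 := by have := hc.quad; push_cast at this; rw [hA]; exact this
  have hden : (0 : ℝ) < h₂ * (q₁ * (q₁ + d)) := by positivity
  have h19 : |(h₁ : ℝ) / h₂ - ρ| ≤ δ := by
    have hdiff : (h₁ : ℝ) / h₂ - ρ = A / (h₂ * (q₁ * (q₁ + d))) := by
      rw [hρ, hA]; field_simp; ring
    rw [hdiff, abs_div, abs_of_pos hden, div_le_iff₀ hden]
    refine hAle.trans ?_
    have h1 : Q ^ 2 ≤ (q₁ : ℝ) * (q₁ + d) := by nlinarith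
    have h2 : H * Q ^ 2 ≤ (h₂ : ℝ) * (q₁ * (q₁ + d)) := mul_le_mul hHh₂ h1 (by positivity) hh₂.le
    calc δ * H * Q ^ 2 = δ * (H * Q ^ 2) := by ring
      _ ≤ δ * ((h₂ : ℝ) * (q₁ * (q₁ + d))) := mul_le_mul_of_nonneg_left h2 hδ.le
  -- (3·20): `|h₁/h₂ - q₂/q₁| ≤ R d/(HQ)`
  have hl : (h₁ : ℝ) * q₁ - h₂ * q₂ = -(r * d) := by
    have := hc.lin
    have h' : ((r * d + h₁ * q₁ - h₂ * q₂ : ℤ) : ℝ) = 0 := by exact_mod_cast this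
    push_cast at h'; linarith
  have hr : |(r : ℝ)| ≤ R := by exact hc.r_lt.le
  have h20 : |(h₁ : ℝ) / h₂ - q₂ / q₁| ≤ R * d / (H * Q) := by
    have hdiff : (h₁ : ℝ) / h₂ - q₂ / q₁ = -(r * d) / (h₂ * q₁) := by
      rw [← hl]; field_simp
    rw [hdiff, abs_div, abs_neg, abs_mul, abs_of_pos hdR, abs_of_pos (mul_pos hh₂ hq1R)]
    rw [div_le_div_iff₀ (mul_pos hh₂ hq1R) (by positivity)]
    have h1 : H * Q ≤ (h₂ : ℝ) * q₁ := mul_le_mul hHh₂ hQq₁ hQ.le hh₂.le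
    have hR0 : 0 ≤ R := le_trans (abs_nonneg _) hr
    calc |(r : ℝ)| * d * (H * Q) ≤ R * d * (H * Q) := by gcongr
      _ ≤ R * d * ((h₂ : ℝ) * q₁) := by gcongr
  -- combine
  have hcomb : |ρ - (q₂ : ℝ) / q₁| ≤ δ + R * d / (H * Q) := by
    calc |ρ - (q₂ : ℝ) / q₁| = |((h₁ : ℝ) / h₂ - q₂ / q₁) - ((h₁ : ℝ) / h₂ - ρ)| := by ring_nf
      _ ≤ |(h₁ : ℝ) / h₂ - q₂ / q₁| + |(h₁ : ℝ) / h₂ - ρ| := abs_sub _ _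
      _ ≤ R * d / (H * Q) + δ := add_le_add h20 h19
      _ = δ + R * d / (H * Q) := by ring
  have hid : ρ - (q₂ : ℝ) / q₁ = q₂ * (q₂ - q₁ - 2 * d) / (q₁ * (q₁ + d)) := by
    rw [hρ]; field_simp; ring
  rw [hid, abs_div, abs_mul, abs_of_pos hq2R, abs_of_pos (by positivity : (0:ℝ) < q₁ * (q₁ + d)),
    div_le_iff₀ (by positivity)] at hcomb
  -- `q₂ |…| ≤ (δ + Rd/(HQ)) q₁ (q₁ + d) ≤ (δ + Rd/(HQ)) · 13 Q · q₂`... use `q₁(q₁+d) ≤ 13 Q q₂`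
  have hkey : (q₁ : ℝ) * (q₁ + d) ≤ 13 * Q * q₂ := by nlinarith
  have hpos : 0 ≤ δ + R * d / (H * Q) := by
    have hR0 : 0 ≤ R := le_trans (abs_nonneg _) hr
    positivity
  have h2 : (q₂ : ℝ) * |(q₂ : ℝ) - q₁ - 2 * d| ≤ (δ + R * d / (H * Q)) * (13 * Q * q₂) :=
    hcomb.trans (mul_le_mul_of_nonneg_left hkey hpos)
  have h3 : |(q₂ : ℝ) - q₁ - 2 * d| ≤ (δ + R * d / (H * Q)) * (13 * Q) := by
    have : (q₂ : ℝ) * |(q₂ : ℝ) - q₁ - 2 * d| ≤ (q₂ : ℝ) * ((δ + R * d / (H * Q)) * (13 * Q)) := by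
      linarith
    exact le_of_mul_le_mul_left this hq2R
  have heq : R * d / (H * Q) * Q = R * d / H := by
    rw [div_mul_eq_mul_div, mul_div_mul_right _ _ hQ.ne']
  calc |(q₂ : ℝ) - q₁ - 2 * d| ≤ (δ + R * d / (H * Q)) * (13 * Q) := h3
    _ = 13 * Q * δ + 13 * (R * d / (H * Q) * Q) := by ring
    _ = 13 * Q * δ + 13 * R * d / H := by rw [heq]; ring

/-! ### Lemma 7, case (a): `δ ≥ 1`, divisor counting -/

/-- Pairs `(h, q)` with `h q = v ≠ 0` and `q > 0` are at most `τ(|v|)` in number. [folklore] -/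
theorem card_le_card_divisors {v : ℤ} (hv : v ≠ 0) (W : Finset (ℤ × ℤ))
    (hW : ∀ w ∈ W, w.1 * w.2 = v ∧ 0 < w.2) : W.card ≤ (Nat.divisors v.natAbs).card := by
  classical
  refine Finset.card_le_card_of_injOn (fun w => w.2.natAbs) (fun w hw => ?_) ?_
  · obtain ⟨h1, h2⟩ := hW w hw
    rw [Finset.mem_coe, Nat.mem_divisors]
    refine ⟨Int.natAbs_dvd_natAbs.mpr ⟨w.1, ?_⟩, Int.natAbs_ne_zero.mpr hv⟩
    rw [← h1, mul_comm]
  · intro w hw w' hw' hww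
    obtain ⟨h1, h2⟩ := hW w hw
    obtain ⟨h1', h2'⟩ := hW w' hw'
    simp only at hww
    have he2 : w.2 = w'.2 := by
      rcases Int.natAbs_eq_natAbs_iff.mp hww with h | h
      · exact h
      · exfalso; linarith
    have he1 : w.1 = w'.1 := by
      have : w.1 * w.2 = w'.1 * w.2 := by rw [h1, he2, h1']
      exact mul_right_cancel₀ h2.ne' this
    exact Prod.ext he1 he2

/-- **[RS] §3.3 (a)** (`δ ≥ 1`): the sextuples of `𝒥(R,Q,H,δ)` with `q₁ > 0` are determined by
`(r, h₁, q₁, d)` (`|d| ≤ (δ+8)Q/2`) up to the `≤ τ(h₁q₁ + rd)` factorizations `h₂ q₂ = h₁ q₁ + r d`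
(`< 4HQ`); with the divisor bound `τ(n) ≤ C_η n^η` this gives at most
`720 C_η (4HQ)^η · R H Q · Qδ` of them. [cite: RobertSargos2002, §3.3 (a)] -/
theorem card_le_a {R Q H δ η Cη : ℝ} (hR : 1 ≤ R) (hQ : 1 ≤ Q) (hRH : 2 * R ≤ H) (hδ : 1 ≤ δ)
    (hη : 0 < η) (hCη : ∀ n : ℕ, n ≠ 0 → ((Nat.divisors n).card : ℝ) ≤ Cη * (n : ℝ) ^ η)
    (S : Finset (ℤ × ℤ × ℤ × ℤ × ℤ × ℤ))
    (hS : ∀ p ∈ S, JCond R Q H δ p.1 p.2.1 p.2.2.1 p.2.2.2.1 p.2.2.2.2.1 p.2.2.2.2.2 ∧ 0 < p.2.1) :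
    (S.card : ℝ) ≤ 720 * Cη * (4 * H * Q) ^ η * (R * H * Q) * (Q * δ) := by
  classical
  have hH : 0 < H := by linarith
  have hQ0 : 0 < Q := by linarith
  -- the finite range of `(r, h₁, q₁, d)`
  set Dm : ℤ := ⌈(δ + 8) * Q / 2⌉ with hDm
  set A : Finset (ℤ × ℤ × ℤ × ℤ) := (Finset.Icc (-⌈R⌉) ⌈R⌉) ×ˢ ((Finset.Icc 0 ⌈2 * H⌉) ×ˢ
    ((Finset.Icc 0 ⌈2 * Q⌉) ×ˢ (Finset.Icc (-Dm) Dm))) with hAdef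
  set f : ℤ × ℤ × ℤ × ℤ × ℤ × ℤ → ℤ × ℤ × ℤ × ℤ := fun p => (p.1, p.2.2.2.1, p.2.1, p.2.2.2.2.2)
    with hf
  have hfA : ∀ p ∈ S, f p ∈ A := by
    intro p hp
    obtain ⟨hc, hq⟩ := hS p hp
    simp only [hf, hAdef, Finset.mem_product, Finset.mem_Icc]
    obtain ⟨h1, h2⟩ := hc.r_lt'
    have h3 := hc.h₁_ge; have h4 := hc.h₁_lt
    have hq1R : (0 : ℝ) < p.2.1 := by exact_mod_cast hq
    have h5 : (p.2.1 : ℝ) < 2 * Q := by have := hc.q₁_lt; rwa [abs_of_pos hq1R] at this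
    have h6 := hc.abs_d_le hRH hq
    have hRc : R ≤ ⌈R⌉ := Int.le_ceil R
    have hHc : 2 * H ≤ ⌈2 * H⌉ := Int.le_ceil _
    have hQc : 2 * Q ≤ ⌈2 * Q⌉ := Int.le_ceil _
    have hDc : (δ + 8) * Q / 2 ≤ Dm := Int.le_ceil _
    obtain ⟨h7, h8⟩ := abs_le.mp h6
    refine ⟨⟨?_, ?_⟩, ⟨?_, ?_⟩, ⟨?_, ?_⟩, ⟨?_, ?_⟩⟩
    · have : (-⌈R⌉ : ℝ) ≤ p.1 := by linarith
      exact_mod_cast this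
    · have : (p.1 : ℝ) ≤ ⌈R⌉ := by linarith
      exact_mod_cast this
    · have : (0 : ℝ) ≤ p.2.2.2.1 := by linarith
      exact_mod_cast this
    · have : (p.2.2.2.1 : ℝ) ≤ ⌈2 * H⌉ := by linarith
      exact_mod_cast this
    · exact hq.le
    · have : (p.2.1 : ℝ) ≤ ⌈2 * Q⌉ := by linarith
      exact_mod_cast this
    · have : (-Dm : ℝ) ≤ p.2.2.2.2.2 := by linarith
      exact_mod_cast this
    · have : (p.2.2.2.2.2 : ℝ) ≤ Dm := by linarith
      exact_mod_cast this
  -- cardinality of `A`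
  have hIcc : ∀ (a b : ℤ) (x : ℝ), (0 : ℝ) ≤ (b : ℝ) + 1 - a → ((b : ℝ) + 1 - a ≤ x) →
      (((Finset.Icc a b).card : ℕ) : ℝ) ≤ x := by
    intro a b x h0 hx
    rw [Int.card_Icc]
    have h0' : (0 : ℤ) ≤ b + 1 - a := by exact_mod_cast h0
    have : (((b + 1 - a).toNat : ℤ) : ℝ) = ((b + 1 - a : ℤ) : ℝ) := by rw [Int.toNat_of_nonneg h0']
    rw [show ((b + 1 - a).toNat : ℝ) = (((b + 1 - a).toNat : ℤ) : ℝ) by norm_cast, this]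
    push_cast; exact hx
  have hRc' := Int.ceil_lt_add_one R
  have hHc' := Int.ceil_lt_add_one (2 * H)
  have hQc' := Int.ceil_lt_add_one (2 * Q)
  have hDc' := Int.ceil_lt_add_one ((δ + 8) * Q / 2)
  have hR0 : (0 : ℝ) ≤ ⌈R⌉ := by exact_mod_cast Int.ceil_nonneg (by linarith : (0 : ℝ) ≤ R)
  have hH0 : (0 : ℝ) ≤ ⌈2 * H⌉ := by exact_mod_cast Int.ceil_nonneg (by linarith : (0 : ℝ) ≤ 2 * H)
  have hQ0' : (0 : ℝ) ≤ ⌈2 * Q⌉ := by exact_mod_cast Int.ceil_nonneg (by linarith : (0 : ℝ) ≤ 2 * Q)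
  have hD0 : (0 : ℝ) ≤ Dm := by
    have : (0 : ℝ) ≤ (δ + 8) * Q / 2 := by positivity
    exact_mod_cast Int.ceil_nonneg this
  have hA1 : (((Finset.Icc (-⌈R⌉) ⌈R⌉).card : ℕ) : ℝ) ≤ 5 * R :=
    hIcc _ _ _ (by push_cast; linarith) (by push_cast; linarith)
  have hA2 : (((Finset.Icc (0 : ℤ) ⌈2 * H⌉).card : ℕ) : ℝ) ≤ 3 * H :=
    hIcc _ _ _ (by push_cast; linarith) (by push_cast; linarith)
  have hA3 : (((Finset.Icc (0 : ℤ) ⌈2 * Q⌉).card : ℕ) : ℝ) ≤ 4 * Q :=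
    hIcc _ _ _ (by push_cast; linarith) (by push_cast; linarith)
  have hA4 : (((Finset.Icc (-Dm) Dm).card : ℕ) : ℝ) ≤ 12 * (Q * δ) := by
    refine hIcc _ _ _ (by push_cast; linarith) ?_
    push_cast
    have : (Dm : ℝ) < (δ + 8) * Q / 2 + 1 := hDc'
    nlinarith
  have hAcard : (A.card : ℝ) ≤ 5 * R * (3 * H) * (4 * Q) * (12 * (Q * δ)) := by
    rw [hAdef, Finset.card_product, Finset.card_product, Finset.card_product]
    push_cast
    have := mul_le_mul hA3 hA4 (by positivity) (by positivity)
    have := mul_le_mul hA2 this (by positivity) (by positivity)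
    have := mul_le_mul hA1 this (by positivity) (by positivity)
    linarith
  -- each fiber has at most `Cη (4HQ)^η` elements
  have hfib : ∀ a ∈ A, ((S.filter fun p => f p = a).card : ℝ) ≤ Cη * (4 * H * Q) ^ η := by
    intro a _
    set F := S.filter fun p => f p = a with hF
    rcases F.eq_empty_or_nonempty with hFe | ⟨p₀, hp₀⟩
    · rw [hFe, Finset.card_empty, Nat.cast_zero]
      have : 0 ≤ Cη := by
        have := hCη 1 one_ne_zero
        simp at this; linarith
      positivity
    -- the common value `v = h₁ q₁ + r d = h₂ q₂`
    have hp₀S : p₀ ∈ S := (Finset.mem_filter.mp hp₀).1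
    have hfp₀ : f p₀ = a := (Finset.mem_filter.mp hp₀).2
    set v : ℤ := p₀.2.2.2.2.1 * p₀.2.2.1 with hv
    obtain ⟨hc₀, hq₀⟩ := hS p₀ hp₀S
    have hq₂₀ := hc₀.q₂_pos hq₀
    have hh₂₀ := hc₀.h₂_pos hRH
    have hv0 : 0 < v := mul_pos hh₂₀ hq₂₀
    set g : ℤ × ℤ × ℤ × ℤ × ℤ × ℤ → ℤ × ℤ := fun p => (p.2.2.2.2.1, p.2.2.1) with hg
    have hinj : Set.InjOn g F := by
      intro p hp p' hp' hpp
      rw [Finset.mem_coe, hF, Finset.mem_filter] at hp hp'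
      have hee := hp.2.trans hp'.2.symm
      simp only [hf, Prod.mk.injEq] at hee
      obtain ⟨e1, e2, e3, e4⟩ := hee
      simp only [hg, Prod.mk.injEq] at hpp
      obtain ⟨e5, e6⟩ := hpp
      exact Prod.ext e1 (Prod.ext e3 (Prod.ext e6 (Prod.ext e2 (Prod.ext e5 e4))))
    have hW : ∀ w ∈ F.image g, w.1 * w.2 = v ∧ 0 < w.2 := by
      intro w hw
      rw [Finset.mem_image] at hw
      obtain ⟨p, hp, rfl⟩ := hw
      rw [hF, Finset.mem_filter] at hp
      obtain ⟨hpS, hfp⟩ := hp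
      obtain ⟨hc, hq⟩ := hS p hpS
      have hee := hfp.trans hfp₀.symm
      simp only [hf, Prod.mk.injEq] at hee
      obtain ⟨e1, e2, e3, e4⟩ := hee
      refine ⟨?_, hc.q₂_pos hq⟩
      simp only [hg]
      have h1 := hc.lin
      have h2 := hc₀.lin
      rw [hv]
      rw [e1, e2, e3, e4] at h1
      linear_combination h2 - h1
    have h1 : F.card ≤ (Nat.divisors v.natAbs).card := by
      rw [← Finset.card_image_of_injOn hinj]
      exact card_le_card_divisors hv0.ne' _ hW
    have h2 : ((Nat.divisors v.natAbs).card : ℝ) ≤ Cη * (v.natAbs : ℝ) ^ η :=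
      hCη _ (Int.natAbs_ne_zero.mpr hv0.ne')
    have h3 : (v.natAbs : ℝ) ≤ 4 * H * Q := by
      rw [Nat.cast_natAbs, Int.cast_abs, abs_of_pos (by exact_mod_cast hv0), hv]
      push_cast
      have hq2R : (0 : ℝ) < p₀.2.2.1 := by exact_mod_cast hq₂₀
      have hh2R : (0 : ℝ) < p₀.2.2.2.2.1 := by exact_mod_cast hh₂₀
      have hq₂Q : (p₀.2.2.1 : ℝ) < 2 * Q := by have := hc₀.q₂_lt; rwa [abs_of_pos hq2R] at this
      have hh₂H : (p₀.2.2.2.2.1 : ℝ) < 2 * H := hc₀.h₂_lt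
      nlinarith
    have hC0 : 0 ≤ Cη := by
      have := hCη 1 one_ne_zero
      simp at this; linarith
    calc (F.card : ℝ) ≤ ((Nat.divisors v.natAbs).card : ℝ) := by exact_mod_cast h1
      _ ≤ Cη * (v.natAbs : ℝ) ^ η := h2
      _ ≤ Cη * (4 * H * Q) ^ η := by
          apply mul_le_mul_of_nonneg_left _ hC0
          exact Real.rpow_le_rpow (by positivity) h3 hη.le
  have h := card_le_card_mul_of_fiber_le S f A hfA hfib
  refine h.trans ?_
  have hC0 : 0 ≤ Cη * (4 * H * Q) ^ η := by
    have : 0 ≤ Cη := by have := hCη 1 one_ne_zero; simp at this; linarith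
    positivity
  calc (A.card : ℝ) * (Cη * (4 * H * Q) ^ η) ≤ (5 * R * (3 * H) * (4 * Q) * (12 * (Q * δ))) *
      (Cη * (4 * H * Q) ^ η) := mul_le_mul_of_nonneg_right hAcard hC0
    _ = 720 * Cη * (4 * H * Q) ^ η * (R * H * Q) * (Q * δ) := by ring

/-! ### Lemma 7, case (c): summation over `(d, q₁, q₂)` -/

/-- The weight `m(d) = min(8δH²/d, 8RH/Q)` bounding a fiber of case (c) minus one. [folklore] -/
noncomputable def mC (R Q H δ : ℝ) (d : ℝ) : ℝ := min (8 * δ * H ^ 2 / d) (8 * R * H / Q)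

/-- The term `T(d) = 2Q (26Qδ + 26Rd/H + 1)(1 + m(d))` of the case-(c) sum. [folklore] -/
noncomputable def TC (R Q H δ : ℝ) (d : ℝ) : ℝ :=
  2 * Q * (26 * Q * δ + 26 * R * d / H + 1) * (1 + mC R Q H δ d)

/-- Auxiliary. [folklore] -/
theorem mC_nonneg {R Q H δ d : ℝ} (hR : 0 ≤ R) (hQ : 0 < Q) (hH : 0 < H) (hδ : 0 < δ) (hd : 0 < d) :
    0 ≤ mC R Q H δ d := by
  unfold mC; exact le_min (by positivity) (by positivity)

/-- Auxiliary. [folklore] -/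
theorem TC_nonneg {R Q H δ d : ℝ} (hR : 0 ≤ R) (hQ : 0 < Q) (hH : 0 < H) (hδ : 0 < δ) (hd : 0 < d) :
    0 ≤ TC R Q H δ d := by
  unfold TC
  have := mC_nonneg hR hQ hH hδ hd
  positivity

/-- **[RS] §3.3 (c), the counting.** For `δ ≤ 1`, the sextuples of `𝒥(R,Q,H,δ)` with `q₁ > 0`
and `d > 0` number at most `∑_{1 ≤ d ≤ 9Q/2} 2Q (26Qδ + 26Rd/H + 1)(1 + min(8δH²/d, 8RH/Q))`:
group them by `(d, q₁, q₂)` (fibers bounded by `card_fiber_c₁`, `card_fiber_c₂`), then by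
`(d, q₁)` (at most `26(Qδ + Rd/H) + 1` values of `q₂` by `abs_q₂_sub_le`), then by `d`
(at most `2Q` values of `q₁`). [cite: RobertSargos2002, §3.3 (c)] -/
theorem card_le_c_sum {R Q H δ : ℝ} (hR : 1 ≤ R) (hQ : 1 ≤ Q) (hRH : 2 * R ≤ H) (hδ : 0 < δ)
    (hδ1 : δ ≤ 1) (S : Finset (ℤ × ℤ × ℤ × ℤ × ℤ × ℤ))
    (hS : ∀ p ∈ S, JCond R Q H δ p.1 p.2.1 p.2.2.1 p.2.2.2.1 p.2.2.2.2.1 p.2.2.2.2.2 ∧ 0 < p.2.1 ∧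
      0 < p.2.2.2.2.2) :
    (S.card : ℝ) ≤ ∑ d ∈ Finset.Icc 1 ⌊9 * Q / 2⌋₊, TC R Q H δ d := by
  classical
  have hH : 0 < H := by linarith
  have hQ0 : 0 < Q := by linarith
  have hR0 : 0 < R := by linarith
  -- Step 1: fibers over `k = (d, q₁, q₂)`
  set F : ℤ × ℤ × ℤ × ℤ × ℤ × ℤ → ℤ × ℤ × ℤ := fun p => (p.2.2.2.2.2, p.2.1, p.2.2.1) with hF
  set K := S.image F with hK
  have hfib : ∀ k ∈ K, ((S.filter fun p => F p = k).card : ℝ) ≤ 1 + mC R Q H δ k.1 := by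
    intro k hk
    obtain ⟨p₀, hp₀, hk₀⟩ := Finset.mem_image.mp hk
    obtain ⟨hc₀, hq₀, hd₀⟩ := hS p₀ hp₀
    have hd : 0 < k.1 := by rw [← hk₀]; exact hd₀
    have hq : 0 < k.2.1 := by rw [← hk₀]; exact hq₀
    set Fk := S.filter fun p => F p = k with hFk
    set g : ℤ × ℤ × ℤ × ℤ × ℤ × ℤ → ℤ × ℤ × ℤ := fun p => (p.2.2.2.1, p.2.2.2.2.1, p.1) with hg
    have hinj : Set.InjOn g Fk := by
      intro p hp p' hp' hpp
      rw [Finset.mem_coe, hFk, Finset.mem_filter] at hp hp'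
      have hee := hp.2.trans hp'.2.symm
      simp only [hF, Prod.mk.injEq] at hee
      obtain ⟨e1, e2, e3⟩ := hee
      simp only [hg, Prod.mk.injEq] at hpp
      obtain ⟨e4, e5, e6⟩ := hpp
      exact Prod.ext e6 (Prod.ext e2 (Prod.ext e3 (Prod.ext e4 (Prod.ext e5 e1))))
    have hU : ∀ t ∈ Fk.image g, JCond R Q H δ t.2.2 k.2.1 k.2.2 t.1 t.2.1 k.1 := by
      intro t ht
      obtain ⟨p, hp, rfl⟩ := Finset.mem_image.mp ht
      rw [hFk, Finset.mem_filter] at hp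
      obtain ⟨hpS, hfp⟩ := hp
      obtain ⟨hc, _, _⟩ := hS p hpS
      simp only [hF] at hfp
      rw [← hfp]
      exact hc
    rw [← Finset.card_image_of_injOn hinj]
    have h1 := card_fiber_c₁ hH hRH hδ hd hq _ hU
    have h2 := card_fiber_c₂ hR0 hQ0 hH hRH hd hq _ hU
    unfold mC
    rcases le_total (8 * δ * H ^ 2 / (k.1 : ℝ)) (8 * R * H / Q) with h | h
    · rw [min_eq_left h]; exact h1
    · rw [min_eq_right h]; exact h2
  have hstep1 : (S.card : ℝ) ≤ ∑ k ∈ K, (1 + mC R Q H δ k.1) := by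
    have hmaps : ∀ p ∈ S, F p ∈ K := fun p hp => Finset.mem_image_of_mem F hp
    rw [Finset.card_eq_sum_card_fiberwise hmaps]
    push_cast
    exact Finset.sum_le_sum hfib
  -- Step 2: group by `g = (d, q₁)`
  set G : ℤ × ℤ × ℤ → ℤ × ℤ := fun k => (k.1, k.2.1) with hG
  set K₂ := K.image G with hK₂
  set L : ℝ → ℝ := fun d => 26 * Q * δ + 26 * R * d / H with hL
  have hKg : ∀ gg ∈ K₂, ((K.filter fun k => G k = gg).card : ℝ) ≤ L gg.1 + 1 := by
    intro gg hgg
    set Kg := K.filter fun k => G k = gg with hKgdef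
    -- `k ↦ q₂` is injective on `Kg` and the values lie in an interval of length `L`
    have hinj : Set.InjOn (fun k : ℤ × ℤ × ℤ => k.2.2) Kg := by
      intro k hk k' hk' hkk
      rw [Finset.mem_coe, hKgdef, Finset.mem_filter] at hk hk'
      have hee := hk.2.trans hk'.2.symm
      simp only [hG, Prod.mk.injEq] at hee
      simp only at hkk
      exact Prod.ext hee.1 (Prod.ext hee.2 hkk)
    rw [← Finset.card_image_of_injOn hinj]
    have hLnn : 0 ≤ L gg.1 := by
      obtain ⟨k, hk, hkg⟩ := Finset.mem_image.mp hgg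
      obtain ⟨p, hp, hpk⟩ := Finset.mem_image.mp hk
      obtain ⟨_, _, hdp⟩ := hS p hp
      have : (0 : ℝ) < gg.1 := by
        rw [← hkg, ← hpk]; simp only [hG, hF]; exact_mod_cast hdp
      simp only [hL]; positivity
    have hL' : L gg.1 = 2 * (13 * Q * δ + 13 * R * gg.1 / H) := by simp only [hL]; ring
    refine card_le_of_forall_mem_Icc _ hLnn
      (x := (gg.2 : ℝ) + 2 * gg.1 - (13 * Q * δ + 13 * R * gg.1 / H)) fun t ht => ?_
    obtain ⟨k, hk, rfl⟩ := Finset.mem_image.mp ht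
    rw [hKgdef, Finset.mem_filter] at hk
    obtain ⟨hkK, hkg⟩ := hk
    obtain ⟨p, hp, hpk⟩ := Finset.mem_image.mp hkK
    obtain ⟨hc, hqp, hdp⟩ := hS p hp
    have key := abs_q₂_sub_le hRH hδ hδ1 hc hqp hdp
    -- translate to `k` and `gg`
    have e1 : p.2.2.2.2.2 = gg.1 := by rw [← hkg, ← hpk]
    have e2 : p.2.1 = gg.2 := by rw [← hkg, ← hpk]
    have e3 : p.2.2.1 = k.2.2 := by rw [← hpk]
    rw [e1, e2, e3] at key
    obtain ⟨k1, k2⟩ := abs_le.mp key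
    constructor <;> linarith
  have hstep2 : ∑ k ∈ K, (1 + mC R Q H δ k.1) ≤ ∑ gg ∈ K₂, (L gg.1 + 1) * (1 + mC R Q H δ gg.1) := by
    have hmaps : ∀ k ∈ K, G k ∈ K₂ := fun k hk => Finset.mem_image_of_mem G hk
    rw [← Finset.sum_fiberwise_of_maps_to hmaps]
    refine Finset.sum_le_sum fun gg hgg => ?_
    have hconst : ∀ k ∈ K.filter (fun k => G k = gg), (1 + mC R Q H δ k.1) = (1 + mC R Q H δ gg.1) := by
      intro k hk
      rw [Finset.mem_filter] at hk
      rw [← hk.2]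
    rw [Finset.sum_congr rfl hconst, Finset.sum_const, nsmul_eq_mul]
    have hpos : 0 ≤ 1 + mC R Q H δ gg.1 := by
      obtain ⟨k, hk, hkg⟩ := Finset.mem_image.mp hgg
      obtain ⟨p, hp, hpk⟩ := Finset.mem_image.mp hk
      obtain ⟨_, _, hdp⟩ := hS p hp
      have : (0 : ℝ) < gg.1 := by
        rw [← hkg, ← hpk]; simp only [hG, hF]; exact_mod_cast hdp
      have := mC_nonneg hR0.le hQ0 hH hδ this
      linarith
    exact mul_le_mul_of_nonneg_right (hKg gg hgg) hpos
  -- Step 3: group by `d`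
  set D := K₂.image (fun gg : ℤ × ℤ => gg.1) with hD
  have hKd : ∀ d ∈ D, ((K₂.filter fun gg => gg.1 = d).card : ℝ) ≤ 2 * Q := by
    intro d hd
    set Kd := K₂.filter fun gg => gg.1 = d with hKddef
    have hinj : Set.InjOn (fun gg : ℤ × ℤ => gg.2) Kd := by
      intro gg hgg gg' hgg' he
      rw [Finset.mem_coe, hKddef, Finset.mem_filter] at hgg hgg'
      simp only at he
      exact Prod.ext (hgg.2.trans hgg'.2.symm) he
    rw [← Finset.card_image_of_injOn hinj]
    have h1 : (((Kd.image fun gg : ℤ × ℤ => gg.2).card : ℕ) : ℝ) ≤ Q + 1 := by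
      refine card_le_of_forall_mem_Icc _ hQ0.le (x := Q) fun t ht => ?_
      obtain ⟨gg, hgg, rfl⟩ := Finset.mem_image.mp ht
      rw [hKddef, Finset.mem_filter] at hgg
      obtain ⟨k, hk, hkg⟩ := Finset.mem_image.mp hgg.1
      obtain ⟨p, hp, hpk⟩ := Finset.mem_image.mp hk
      obtain ⟨hc, hqp, _⟩ := hS p hp
      have e2 : p.2.1 = gg.2 := by rw [← hkg, ← hpk]
      have hq1R : (0 : ℝ) < p.2.1 := by exact_mod_cast hqp
      have := hc.q₁_ge; have h' := hc.q₁_lt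
      rw [abs_of_pos hq1R, e2] at this h'
      constructor <;> linarith
    linarith
  have hstep3 : ∑ gg ∈ K₂, (L gg.1 + 1) * (1 + mC R Q H δ gg.1) ≤
      ∑ d ∈ D, 2 * Q * ((L d + 1) * (1 + mC R Q H δ d)) := by
    have hmaps : ∀ gg ∈ K₂, gg.1 ∈ D := fun gg hgg => Finset.mem_image_of_mem _ hgg
    rw [← Finset.sum_fiberwise_of_maps_to hmaps]
    refine Finset.sum_le_sum fun d hd => ?_
    have hconst : ∀ gg ∈ K₂.filter (fun gg => gg.1 = d),
        (L gg.1 + 1) * (1 + mC R Q H δ gg.1) = (L d + 1) * (1 + mC R Q H δ d) := by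
      intro gg hgg
      rw [Finset.mem_filter] at hgg
      rw [← hgg.2]
    rw [Finset.sum_congr rfl hconst, Finset.sum_const, nsmul_eq_mul]
    have hpos : 0 ≤ (L d + 1) * (1 + mC R Q H δ d) := by
      obtain ⟨gg, hgg, hgd⟩ := Finset.mem_image.mp hd
      obtain ⟨k, hk, hkg⟩ := Finset.mem_image.mp hgg
      obtain ⟨p, hp, hpk⟩ := Finset.mem_image.mp hk
      obtain ⟨_, _, hdp⟩ := hS p hp
      have hdpos : (0 : ℝ) < d := by
        rw [← hgd, ← hkg, ← hpk]; simp only [hG, hF]; exact_mod_cast hdp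
      have := mC_nonneg hR0.le hQ0 hH hδ hdpos
      have : 0 ≤ L d := by simp only [hL]; positivity
      positivity
    exact mul_le_mul_of_nonneg_right (hKd d hd) hpos
  -- Step 4: `D ⊆ [1, 9Q/2]`
  have hDsub : D ⊆ (Finset.Icc 1 ⌊9 * Q / 2⌋₊).image (fun n : ℕ => (n : ℤ)) := by
    intro d hd
    obtain ⟨gg, hgg, hgd⟩ := Finset.mem_image.mp hd
    obtain ⟨k, hk, hkg⟩ := Finset.mem_image.mp hgg
    obtain ⟨p, hp, hpk⟩ := Finset.mem_image.mp hk
    obtain ⟨hc, hqp, hdp⟩ := hS p hp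
    have e1 : p.2.2.2.2.2 = d := by rw [← hgd, ← hkg, ← hpk]
    have hdle := hc.abs_d_le hRH hqp
    rw [abs_of_pos (by exact_mod_cast hdp : (0 : ℝ) < p.2.2.2.2.2), e1] at hdle
    rw [e1] at hdp
    rw [Finset.mem_image]
    refine ⟨d.toNat, ?_, Int.toNat_of_nonneg hdp.le⟩
    rw [Finset.mem_Icc]
    constructor
    · have : (1 : ℤ) ≤ d := hdp; omega
    · apply Nat.le_floor
      have : ((d.toNat : ℤ) : ℝ) = (d : ℝ) := by rw [Int.toNat_of_nonneg hdp.le]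
      rw [show (d.toNat : ℝ) = ((d.toNat : ℤ) : ℝ) by norm_cast, this]
      nlinarith
  have hstep4 : ∑ d ∈ D, 2 * Q * ((L d + 1) * (1 + mC R Q H δ d)) ≤
      ∑ d ∈ Finset.Icc 1 ⌊9 * Q / 2⌋₊, TC R Q H δ d := by
    have heq : ∀ d : ℤ, 2 * Q * ((L d + 1) * (1 + mC R Q H δ d)) = TC R Q H δ d := by
      intro d; simp only [hL, TC]; ring
    simp_rw [heq]
    have hRHS : ∑ d ∈ Finset.Icc 1 ⌊9 * Q / 2⌋₊, TC R Q H δ (d : ℝ) =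
        ∑ x ∈ (Finset.Icc 1 ⌊9 * Q / 2⌋₊).image (fun n : ℕ => (n : ℤ)), TC R Q H δ (x : ℝ) := by
      rw [Finset.sum_image (fun a _ b _ h => by exact_mod_cast h)]
      simp only [Int.cast_natCast]
    rw [hRHS]
    refine Finset.sum_le_sum_of_subset_of_nonneg hDsub fun d hd _ => ?_
    obtain ⟨n, hn, rfl⟩ := Finset.mem_image.mp hd
    rw [Finset.mem_Icc] at hn
    have : (0 : ℝ) < ((n : ℤ) : ℝ) := by have := hn.1; exact_mod_cast this
    exact TC_nonneg hR0.le hQ0 hH hδ this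
  exact hstep1.trans (hstep2.trans (hstep3.trans hstep4))

/-! ### Lemma 7, case (c): the elementary estimate of the sum -/

/-- `∑_{d=1}^{N} 1/d ≤ 1 + log N`. [folklore] -/
theorem harmonic_Icc_le {N : ℕ} (hN : 1 ≤ N) :
    ∑ d ∈ Finset.Icc 1 N, (1 : ℝ) / d ≤ 1 + Real.log N := by
  induction N, hN using Nat.le_induction with
  | base => simp
  | succ n hn ih =>
    rw [Finset.sum_Icc_succ_top (by omega), Nat.cast_succ]
    have hn0 : (0 : ℝ) < n := by exact_mod_cast hn
    have hstep : 1 / ((n : ℝ) + 1) ≤ Real.log ((n : ℝ) + 1) - Real.log n := by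
      have h1 : Real.log ((n : ℝ) / (n + 1)) ≤ (n : ℝ) / (n + 1) - 1 :=
        Real.log_le_sub_one_of_pos (by positivity)
      rw [Real.log_div hn0.ne' (by positivity)] at h1
      have h2 : (n : ℝ) / (n + 1) - 1 = -(1 / ((n : ℝ) + 1)) := by field_simp; ring
      linarith
    linarith

/-- The sum of case (c): for `R, Q ≥ 1`, `Q ≤ H`, `δ > 0`, `1 ≤ N ≤ 9Q/2`,
`∑_{d=1}^{N} 2Q(26Qδ + 26Rd/H + 1)(1 + min(8δH²/d, 8RH/Q)) ≤ 5200 RHQ (1 + Qδ)(1 + log N)`.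
[cite: RobertSargos2002, §3.3 (c)] -/
theorem sum_TC_le {R Q H δ : ℝ} (hR : 1 ≤ R) (hQ : 1 ≤ Q) (hQH : Q ≤ H) (hδ : 0 < δ) {N : ℕ}
    (hN1 : 1 ≤ N) (hN : (N : ℝ) ≤ 9 * Q / 2) :
    ∑ d ∈ Finset.Icc 1 N, TC R Q H δ d ≤
      5200 * (R * H * Q) * (1 + Q * δ) * (1 + Real.log N) := by
  have hQ0 : 0 < Q := by linarith
  have hH : 0 < H := by linarith
  have hR0 : 0 < R := by linarith
  set ℓ : ℝ := 1 + Real.log N with hℓ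
  have hℓ1 : 1 ≤ ℓ := by
    have : 0 ≤ Real.log N := Real.log_nonneg (by exact_mod_cast hN1)
    linarith
  have hd : ∀ d ∈ Finset.Icc 1 N, (1 : ℝ) ≤ d ∧ (d : ℝ) ≤ N := by
    intro d hd
    rw [Finset.mem_Icc] at hd
    exact ⟨by exact_mod_cast hd.1, by exact_mod_cast hd.2⟩
  -- pointwise decomposition and bounds
  have hm_le1 : ∀ d ∈ Finset.Icc 1 N, (d : ℝ) * mC R Q H δ d ≤ 8 * δ * H ^ 2 := by
    intro d hdd
    have hd1 := (hd d hdd).1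
    have : mC R Q H δ d ≤ 8 * δ * H ^ 2 / d := min_le_left _ _
    calc (d : ℝ) * mC R Q H δ d ≤ d * (8 * δ * H ^ 2 / d) :=
          mul_le_mul_of_nonneg_left this (by linarith)
      _ = 8 * δ * H ^ 2 := by field_simp
  -- `∑ m(d) ≤ 36 R H ℓ`
  have hsum_m : ∑ d ∈ Finset.Icc 1 N, mC R Q H δ d ≤ 36 * R * H * ℓ := by
    rcases le_or_gt (δ * H) R with h | h
    · -- `m(d) ≤ 8δH²/d`, harmonic sum
      calc ∑ d ∈ Finset.Icc 1 N, mC R Q H δ d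
          ≤ ∑ d ∈ Finset.Icc 1 N, 8 * δ * H ^ 2 * (1 / (d : ℝ)) :=
            Finset.sum_le_sum fun d _ => by rw [mul_one_div]; exact min_le_left _ _
        _ = 8 * δ * H ^ 2 * ∑ d ∈ Finset.Icc 1 N, (1 / (d : ℝ)) := by rw [Finset.mul_sum]
        _ ≤ 8 * δ * H ^ 2 * ℓ := mul_le_mul_of_nonneg_left (harmonic_Icc_le hN1) (by positivity)
        _ = 8 * (δ * H) * H * ℓ := by ring
        _ ≤ 8 * R * H * ℓ := by gcongr
        _ ≤ 36 * R * H * ℓ := by nlinarith [mul_pos hR0 hH]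
    · -- `m(d) ≤ 8RH/Q`, `N` terms
      calc ∑ d ∈ Finset.Icc 1 N, mC R Q H δ d
          ≤ ∑ d ∈ Finset.Icc 1 N, 8 * R * H / Q := Finset.sum_le_sum fun d _ => min_le_right _ _
        _ = N * (8 * R * H / Q) := by rw [Finset.sum_const, Nat.card_Icc, nsmul_eq_mul]; norm_num
        _ ≤ 9 * Q / 2 * (8 * R * H / Q) := mul_le_mul_of_nonneg_right hN (by positivity)
        _ = 36 * R * H := by field_simp; ring
        _ ≤ 36 * R * H * ℓ := le_mul_of_one_le_right (by positivity) hℓ1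
  -- `∑ (1 + m(d)) ≤ 9Q/2 + 36 R H ℓ`
  have hsum_1m : ∑ d ∈ Finset.Icc 1 N, (1 + mC R Q H δ d) ≤ 9 * Q / 2 + 36 * R * H * ℓ := by
    rw [Finset.sum_add_distrib, Finset.sum_const, Nat.card_Icc, nsmul_eq_mul, mul_one]
    norm_num
    linarith
  -- `∑ d (1 + m(d)) ≤ N² + 8δH² N ≤ (81/4) Q² + 36 δ H² Q`
  have hsum_d : ∑ d ∈ Finset.Icc 1 N, (d : ℝ) * (1 + mC R Q H δ d) ≤
      81 / 4 * Q ^ 2 + 36 * δ * H ^ 2 * Q := by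
    calc ∑ d ∈ Finset.Icc 1 N, (d : ℝ) * (1 + mC R Q H δ d)
        ≤ ∑ d ∈ Finset.Icc 1 N, ((N : ℝ) + 8 * δ * H ^ 2) :=
          Finset.sum_le_sum fun d hdd => by
            have := hm_le1 d hdd; have := (hd d hdd).2; nlinarith
      _ = N * ((N : ℝ) + 8 * δ * H ^ 2) := by
          rw [Finset.sum_const, Nat.card_Icc, nsmul_eq_mul]; norm_num
      _ ≤ 9 * Q / 2 * (9 * Q / 2 + 8 * δ * H ^ 2) := by
          have hN0 : (0 : ℝ) ≤ N := by positivity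
          exact mul_le_mul hN (by linarith) (by positivity) (by positivity)
      _ = 81 / 4 * Q ^ 2 + 36 * δ * H ^ 2 * Q := by ring
  -- assemble
  have hTC : ∀ d ∈ Finset.Icc 1 N, TC R Q H δ d =
      2 * Q * (26 * Q * δ + 1) * (1 + mC R Q H δ d) +
        52 * (Q * R / H) * ((d : ℝ) * (1 + mC R Q H δ d)) := by
    intro d _; simp only [TC]; field_simp; ring
  rw [Finset.sum_congr rfl hTC, Finset.sum_add_distrib, ← Finset.mul_sum, ← Finset.mul_sum]
  set P : ℝ := R * H * Q with hP
  have hP0 : 0 < P := by positivity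
  set X : ℝ := Q * δ with hX
  have hX0 : 0 ≤ X := by positivity
  -- the two pieces
  have hA : 2 * Q * (26 * Q * δ + 1) * ∑ d ∈ Finset.Icc 1 N, (1 + mC R Q H δ d) ≤
      234 * (P * X) + 1872 * (P * X * ℓ) + 9 * P + 72 * (P * ℓ) := by
    have h1 : 2 * Q * (26 * Q * δ + 1) * ∑ d ∈ Finset.Icc 1 N, (1 + mC R Q H δ d) ≤
        2 * Q * (26 * Q * δ + 1) * (9 * Q / 2 + 36 * R * H * ℓ) :=
      mul_le_mul_of_nonneg_left hsum_1m (by positivity)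
    refine h1.trans ?_
    have e : 2 * Q * (26 * Q * δ + 1) * (9 * Q / 2 + 36 * R * H * ℓ) =
        234 * (Q ^ 3 * δ) + 1872 * (P * X * ℓ) + 9 * Q ^ 2 + 72 * (P * ℓ) := by
      simp only [hP, hX]; ring
    rw [e]
    have hQRH : Q ≤ R * H := le_trans hQH (le_mul_of_one_le_left hH.le hR)
    have i1 : Q ^ 3 * δ ≤ P * X := by
      have := mul_le_mul_of_nonneg_right hQRH (by positivity : (0 : ℝ) ≤ Q ^ 2 * δ)
      calc Q ^ 3 * δ = Q * (Q ^ 2 * δ) := by ring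
        _ ≤ R * H * (Q ^ 2 * δ) := this
        _ = P * X := by simp only [hP, hX]; ring
    have i2 : Q ^ 2 ≤ P := by
      calc Q ^ 2 = Q * Q := by ring
        _ ≤ R * H * Q := mul_le_mul_of_nonneg_right hQRH hQ0.le
        _ = P := by simp only [hP]
    linarith
  have hB : 52 * (Q * R / H) * ∑ d ∈ Finset.Icc 1 N, ((d : ℝ) * (1 + mC R Q H δ d)) ≤
      1053 * P + 1872 * (P * X) := by
    have h1 : 52 * (Q * R / H) * ∑ d ∈ Finset.Icc 1 N, ((d : ℝ) * (1 + mC R Q H δ d)) ≤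
        52 * (Q * R / H) * (81 / 4 * Q ^ 2 + 36 * δ * H ^ 2 * Q) :=
      mul_le_mul_of_nonneg_left hsum_d (by positivity)
    refine h1.trans ?_
    have e : 52 * (Q * R / H) * (81 / 4 * Q ^ 2 + 36 * δ * H ^ 2 * Q) =
        1053 * (R * Q ^ 3 / H) + 1872 * (P * X) := by
      simp only [hP, hX]; field_simp; ring
    rw [e]
    have i3 : R * Q ^ 3 / H ≤ P := by
      simp only [hP]
      rw [div_le_iff₀ hH]
      have : Q ^ 2 ≤ H ^ 2 := pow_le_pow_left₀ hQ0.le hQH 2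
      nlinarith [mul_pos hR0 hQ0]
    linarith
  -- final
  have hXℓ : P * X ≤ P * X * ℓ := le_mul_of_one_le_right (by positivity) hℓ1
  have hPℓ : P ≤ P * ℓ := le_mul_of_one_le_right hP0.le hℓ1
  have htot : 234 * (P * X) + 1872 * (P * X * ℓ) + 9 * P + 72 * (P * ℓ) + (1053 * P + 1872 * (P * X)) ≤
      5200 * P * (1 + X) * ℓ := by nlinarith
  linarith

/-- **[RS] §3.3 (c), conclusion**: for `δ ≤ 1` and `Q ≤ H`, the sextuples of `𝒥(R,Q,H,δ)` with
`q₁ > 0`, `d > 0` number at most `5200 RHQ (1 + Qδ)(1 + log(9Q/2))`.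
[cite: RobertSargos2002, (3.12), §3.3 (c)] -/
theorem card_le_c {R Q H δ : ℝ} (hR : 1 ≤ R) (hQ : 1 ≤ Q) (hQH : Q ≤ H) (hRH : 2 * R ≤ H)
    (hδ : 0 < δ) (hδ1 : δ ≤ 1) (S : Finset (ℤ × ℤ × ℤ × ℤ × ℤ × ℤ))
    (hS : ∀ p ∈ S, JCond R Q H δ p.1 p.2.1 p.2.2.1 p.2.2.2.1 p.2.2.2.2.1 p.2.2.2.2.2 ∧ 0 < p.2.1 ∧
      0 < p.2.2.2.2.2) :
    (S.card : ℝ) ≤ 5200 * (R * H * Q) * (1 + Q * δ) * (1 + Real.log (9 * Q / 2)) := by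
  have h1 := card_le_c_sum hR hQ hRH hδ hδ1 S hS
  set N : ℕ := ⌊9 * Q / 2⌋₊ with hNdef
  have hN1 : 1 ≤ N := by
    rw [hNdef]; apply Nat.le_floor; norm_num; linarith
  have hN : (N : ℝ) ≤ 9 * Q / 2 := Nat.floor_le (by linarith)
  have h2 := sum_TC_le hR hQ hQH hδ hN1 hN
  have hlog : Real.log N ≤ Real.log (9 * Q / 2) :=
    Real.log_le_log (by exact_mod_cast hN1) hN
  have hP : 0 ≤ 5200 * (R * H * Q) * (1 + Q * δ) := by
    have : 0 < H := by linarith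
    positivity
  calc (S.card : ℝ) ≤ _ := h1
    _ ≤ _ := h2
    _ ≤ 5200 * (R * H * Q) * (1 + Q * δ) * (1 + Real.log (9 * Q / 2)) := by
        apply mul_le_mul_of_nonneg_left _ hP; linarith

/-! ### Lemma 7 -/

/-- The symmetry `(r,q₁,q₂,h₁,h₂,d) ↦ (r,q₂,q₁,h₂,h₁,-d)` of `𝒥`. [folklore] -/
def swapMap : ℤ × ℤ × ℤ × ℤ × ℤ × ℤ → ℤ × ℤ × ℤ × ℤ × ℤ × ℤ :=
  fun p => (p.1, p.2.2.1, p.2.1, p.2.2.2.2.1, p.2.2.2.1, -p.2.2.2.2.2)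

/-- The symmetry `(r,q₁,q₂,h₁,h₂,d) ↦ (r,-q₁,-q₂,h₁,h₂,-d)` of `𝒥`. [folklore] -/
def negMap : ℤ × ℤ × ℤ × ℤ × ℤ × ℤ → ℤ × ℤ × ℤ × ℤ × ℤ × ℤ :=
  fun p => (p.1, -p.2.1, -p.2.2.1, p.2.2.2.1, p.2.2.2.2.1, -p.2.2.2.2.2)

/-- Auxiliary. [folklore] -/
theorem swapMap_injective : Function.Injective swapMap := by
  intro p p' h
  simp only [swapMap, Prod.mk.injEq, neg_inj] at h
  obtain ⟨e1, e2, e3, e4, e5, e6⟩ := h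
  exact Prod.ext e1 (Prod.ext e3 (Prod.ext e2 (Prod.ext e5 (Prod.ext e4 e6))))

/-- Auxiliary. [folklore] -/
theorem negMap_injective : Function.Injective negMap := by
  intro p p' h
  simp only [negMap, Prod.mk.injEq, neg_inj] at h
  obtain ⟨e1, e2, e3, e4, e5, e6⟩ := h
  exact Prod.ext e1 (Prod.ext e2 (Prod.ext e3 (Prod.ext e4 (Prod.ext e5 e6))))

/-- `1 ≤ 1 + log(9Q/2)` for `Q ≥ 1`. [folklore] -/
theorem one_le_one_add_log {Q : ℝ} (hQ : 1 ≤ Q) : 1 ≤ 1 + Real.log (9 * Q / 2) := by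
  have : 0 ≤ Real.log (9 * Q / 2) := Real.log_nonneg (by linarith)
  linarith

/-- **[RS] Lemma 7, sextuples with `q₁ > 0`.** With the divisor bound `τ(n) ≤ C_η n^η` as input,
`#{q₁ > 0 part of 𝒥(R,Q,H,δ)} ≤ 10400 C_η (4HQ)^η RHQ (1 + Qδ)(1 + log(9Q/2))`, combining the
cases (a) `δ ≥ 1`, (b) `δ < 1, H ≤ Q`, (c) `δ < 1, Q < H` (the part `d < 0` of (c) is mapped to
`d > 0` by `swapMap`). [cite: RobertSargos2002, Lemma 7, (3.12)] -/
theorem lemma7_pos {R Q H δ η Cη : ℝ} (hR : 1 ≤ R) (hQ : 1 ≤ Q) (hRH : 2 * R ≤ H) (hδ : 0 < δ)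
    (hη : 0 < η) (hCη1 : 1 ≤ Cη)
    (hCη : ∀ n : ℕ, n ≠ 0 → ((Nat.divisors n).card : ℝ) ≤ Cη * (n : ℝ) ^ η)
    (S : Finset (ℤ × ℤ × ℤ × ℤ × ℤ × ℤ))
    (hS : ∀ p ∈ S, JCond R Q H δ p.1 p.2.1 p.2.2.1 p.2.2.2.1 p.2.2.2.2.1 p.2.2.2.2.2 ∧ 0 < p.2.1) :
    (S.card : ℝ) ≤ 10400 * (Cη * (4 * H * Q) ^ η) * (R * H * Q) * (1 + Q * δ) *
      (1 + Real.log (9 * Q / 2)) := by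
  classical
  have hH : 0 < H := by linarith
  have hQ0 : 0 < Q := by linarith
  have hR0 : 0 < R := by linarith
  set W : ℝ := Cη * (4 * H * Q) ^ η with hW
  have hW1 : 1 ≤ W := by
    have h1 : (1 : ℝ) ≤ (4 * H * Q) ^ η := Real.one_le_rpow (by nlinarith) hη.le
    nlinarith
  set ℓ : ℝ := 1 + Real.log (9 * Q / 2) with hℓ
  have hℓ1 : 1 ≤ ℓ := one_le_one_add_log hQ
  set P : ℝ := R * H * Q with hP
  have hP0 : 0 < P := by positivity
  have hX0 : 0 ≤ Q * δ := by positivity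
  -- a convenient target
  have hbig : ∀ c x : ℝ, 0 ≤ c → c ≤ 10400 → x ≤ c * P * (1 + Q * δ) * ℓ →
      x ≤ 10400 * W * P * (1 + Q * δ) * ℓ := by
    intro c x hc0 hc hx
    refine hx.trans ?_
    have h1 : c * P * (1 + Q * δ) * ℓ ≤ 10400 * P * (1 + Q * δ) * ℓ := by gcongr
    have h2 : 10400 * P * (1 + Q * δ) * ℓ * 1 ≤ 10400 * P * (1 + Q * δ) * ℓ * W := by gcongr
    linarith
  by_cases hδ1 : 1 ≤ δ
  · -- case (a)
    have ha := card_le_a hR hQ hRH hδ1 hη hCη S hS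
    have : 720 * Cη * (4 * H * Q) ^ η * (R * H * Q) * (Q * δ) ≤ 10400 * W * P * (1 + Q * δ) * ℓ := by
      have h1 : 720 * Cη * (4 * H * Q) ^ η * (R * H * Q) * (Q * δ) = 720 * W * P * (Q * δ) := by
        simp only [hW, hP]; ring
      rw [h1]
      have hW0 : 0 ≤ W := by linarith
      have h2 : 720 * W * P * (Q * δ) ≤ 720 * W * P * (1 + Q * δ) := by gcongr; linarith
      have h3 : 720 * W * P * (1 + Q * δ) * 1 ≤ 10400 * W * P * (1 + Q * δ) * ℓ := by
        gcongr; norm_num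
      linarith
    exact ha.trans this
  · rw [not_le] at hδ1
    by_cases hHQ : H ≤ Q
    · -- case (b)
      have hb := card_le_b hR hRH hδ S hS
      refine hbig 1440 _ (by norm_num) (by norm_num) (hb.trans ?_)
      have h1 : 45 * R * H ^ 2 * (1 + 32 * δ * Q ^ 2 / H) =
          45 * (R * H * H) + 1440 * (R * H * Q) * (Q * δ) := by
        field_simp; ring
      rw [h1]
      have h2 : R * H * H ≤ P := by simp only [hP]; gcongr
      have h3 : 45 * (R * H * H) + 1440 * (R * H * Q) * (Q * δ) ≤ 1440 * P * (1 + Q * δ) := by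
        simp only [hP] at h2 ⊢; nlinarith [mul_nonneg (mul_nonneg hR0.le hH.le) hQ0.le]
      have h4 : 1440 * P * (1 + Q * δ) * 1 ≤ 1440 * P * (1 + Q * δ) * ℓ := by gcongr
      linarith
    · -- case (c): split by the sign of `d`
      rw [not_le] at hHQ
      set Sp := S.filter fun p => 0 < p.2.2.2.2.2 with hSp
      set Sm := S.filter fun p => p.2.2.2.2.2 < 0 with hSm
      have hsub : S ⊆ Sp ∪ Sm := by
        intro p hp
        obtain ⟨hc, _⟩ := hS p hp
        rw [Finset.mem_union, hSp, hSm, Finset.mem_filter, Finset.mem_filter]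
        rcases lt_trichotomy p.2.2.2.2.2 0 with h | h | h
        · exact Or.inr ⟨hp, h⟩
        · exact absurd h hc.d_ne
        · exact Or.inl ⟨hp, h⟩
      have hcard : S.card ≤ Sp.card + Sm.card :=
        (Finset.card_le_card hsub).trans (Finset.card_union_le _ _)
      have hSp_le : (Sp.card : ℝ) ≤ 5200 * (R * H * Q) * (1 + Q * δ) * ℓ := by
        refine card_le_c hR hQ hHQ.le hRH hδ hδ1.le Sp fun p hp => ?_
        rw [hSp, Finset.mem_filter] at hp
        obtain ⟨hc, hq⟩ := hS p hp.1
        exact ⟨hc, hq, hp.2⟩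
      have hSm_le : (Sm.card : ℝ) ≤ 5200 * (R * H * Q) * (1 + Q * δ) * ℓ := by
        rw [← Finset.card_image_of_injective Sm swapMap_injective]
        refine card_le_c hR hQ hHQ.le hRH hδ hδ1.le _ fun t ht => ?_
        obtain ⟨p, hp, rfl⟩ := Finset.mem_image.mp ht
        rw [hSm, Finset.mem_filter] at hp
        obtain ⟨hc, hq⟩ := hS p hp.1
        simp only [swapMap]
        exact ⟨hc.swap, hc.q₂_pos hq, by linarith [hp.2]⟩
      refine hbig 10400 _ (by norm_num) le_rfl ?_
      have : (S.card : ℝ) ≤ Sp.card + Sm.card := by exact_mod_cast hcard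
      calc (S.card : ℝ) ≤ Sp.card + Sm.card := this
        _ ≤ 2 * (5200 * (R * H * Q) * (1 + Q * δ) * ℓ) := by linarith
        _ = 10400 * P * (1 + Q * δ) * ℓ := by simp only [hP]; ring

/-- **[RS] Lemma 7.** For `R, Q ≥ 1`, `H ≥ 2R`, `δ > 0` and the divisor bound `τ(n) ≤ C_η n^η` as
input: `𝒥(R,Q,H,δ) ≤ 20800 C_η (4HQ)^η · RHQ (1 + Qδ)(1 + log(9Q/2))` — the printed
`𝒥 ≪_ε (RQH)^{1+ε}(1 + Qδ)` with the `ε`-losses made explicit (`η` and the logarithm).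
[cite: RobertSargos2002, Lemma 7, (3.12)] -/
theorem lemma7 {R Q H δ η Cη : ℝ} (hR : 1 ≤ R) (hQ : 1 ≤ Q) (hRH : 2 * R ≤ H) (hδ : 0 < δ)
    (hη : 0 < η) (hCη1 : 1 ≤ Cη)
    (hCη : ∀ n : ℕ, n ≠ 0 → ((Nat.divisors n).card : ℝ) ≤ Cη * (n : ℝ) ^ η)
    (S : Finset (ℤ × ℤ × ℤ × ℤ × ℤ × ℤ))
    (hS : ∀ p ∈ S, JCond R Q H δ p.1 p.2.1 p.2.2.1 p.2.2.2.1 p.2.2.2.2.1 p.2.2.2.2.2) :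
    (S.card : ℝ) ≤ 20800 * (Cη * (4 * H * Q) ^ η) * (R * H * Q) * (1 + Q * δ) *
      (1 + Real.log (9 * Q / 2)) := by
  classical
  have hQ0 : 0 < Q := by linarith
  set Sp := S.filter fun p => 0 < p.2.1 with hSp
  set Sm := S.filter fun p => p.2.1 < 0 with hSm
  have hsub : S ⊆ Sp ∪ Sm := by
    intro p hp
    have hc := hS p hp
    rw [Finset.mem_union, hSp, hSm, Finset.mem_filter, Finset.mem_filter]
    rcases lt_trichotomy p.2.1 0 with h | h | h
    · exact Or.inr ⟨hp, h⟩
    · exfalso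
      have := hc.q₁_ge
      rw [h] at this; simp at this; linarith
    · exact Or.inl ⟨hp, h⟩
  have hcard : S.card ≤ Sp.card + Sm.card :=
    (Finset.card_le_card hsub).trans (Finset.card_union_le _ _)
  have hSp_le := lemma7_pos hR hQ hRH hδ hη hCη1 hCη Sp fun p hp => by
    rw [hSp, Finset.mem_filter] at hp
    exact ⟨hS p hp.1, hp.2⟩
  have hSm_le : (Sm.card : ℝ) ≤ 10400 * (Cη * (4 * H * Q) ^ η) * (R * H * Q) * (1 + Q * δ) *
      (1 + Real.log (9 * Q / 2)) := by
    rw [← Finset.card_image_of_injective Sm negMap_injective]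
    refine lemma7_pos hR hQ hRH hδ hη hCη1 hCη _ fun t ht => ?_
    obtain ⟨p, hp, rfl⟩ := Finset.mem_image.mp ht
    rw [hSm, Finset.mem_filter] at hp
    have hc := hS p hp.1
    simp only [negMap]
    exact ⟨hc.neg, by linarith [hp.2]⟩
  have : (S.card : ℝ) ≤ Sp.card + Sm.card := by exact_mod_cast hcard
  linarith

/-! ### Theorem 2: the septuples `𝒩(R,Q,H,N,δ)` and Lemma 6 -/

/-- The conditions defining the count `𝒩(R,Q,H,N,δ)` of [RS] §3.1 on a septuple
`(r, q₁, q₂, h₁, h₂, n₁, n₂) ∈ ℤ⁷`: the domain (3·1) and the system (3·2).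
[cite: RobertSargos2002, (3.1)-(3.2)] -/
structure NCond (R Q H N δ : ℝ) (r q₁ q₂ h₁ h₂ n₁ n₂ : ℤ) : Prop where
  r_ne : r ≠ 0
  r_lt : (|r| : ℝ) < R
  q₁_ge : Q ≤ (|q₁| : ℝ)
  q₁_lt : (|q₁| : ℝ) < 2 * Q
  q₂_ge : Q ≤ (|q₂| : ℝ)
  q₂_lt : (|q₂| : ℝ) < 2 * Q
  qq : 0 < q₁ * q₂
  h₁_ge : H ≤ (h₁ : ℝ)
  h₁_lt : (h₁ : ℝ) < 2 * H
  h₂_ge : H ≤ (h₂ : ℝ)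
  h₂_lt : (h₂ : ℝ) < 2 * H
  n₁_ge : 1 ≤ n₁
  n₁_le : (n₁ : ℝ) ≤ N
  n₂_ge : 1 ≤ n₂
  n₂_le : (n₂ : ℝ) ≤ N
  lin : r * n₁ + h₁ * q₁ = r * n₂ + h₂ * q₂
  quad : (|((r * n₁ ^ 2 + 2 * h₁ * q₁ * n₁ + h₁ * q₁ ^ 2) -
      (r * n₂ ^ 2 + 2 * h₂ * q₂ * n₂ + h₂ * q₂ ^ 2) : ℤ)| : ℝ) ≤ δ * H * Q ^ 2

/-- **[RS] Lemma 6, the substitution `n₁ = n₂ + d`.** A septuple of `𝒩` yields a sextuple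
satisfying (3·4), (3·5)/(3·8) with `d = n₁ - n₂` ("the terms containing `n₂` cancel out each
other"). [cite: RobertSargos2002, Lemma 6, (3.5), (3.8)] -/
theorem NCond.toKCond {R Q H N δ : ℝ} {r q₁ q₂ h₁ h₂ n₁ n₂ : ℤ}
    (hc : NCond R Q H N δ r q₁ q₂ h₁ h₂ n₁ n₂) : KCond R Q H δ r q₁ q₂ h₁ h₂ (n₁ - n₂) where
  r_ne := hc.r_ne
  r_lt := hc.r_lt
  q₁_ge := hc.q₁_ge
  q₁_lt := hc.q₁_lt
  q₂_ge := hc.q₂_ge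
  q₂_lt := hc.q₂_lt
  qq := hc.qq
  h₁_ge := hc.h₁_ge
  h₁_lt := hc.h₁_lt
  h₂_ge := hc.h₂_ge
  h₂_lt := hc.h₂_lt
  lin := by have := hc.lin; linear_combination this
  quad := by
    have hq := hc.quad
    have hl : r * (n₁ - n₂) + h₁ * q₁ - h₂ * q₂ = 0 := by have := hc.lin; linear_combination this
    have heq : (h₁ * q₁ + h₂ * q₂) * (n₁ - n₂) + h₁ * q₁ ^ 2 - h₂ * q₂ ^ 2 =
        (r * n₁ ^ 2 + 2 * h₁ * q₁ * n₁ + h₁ * q₁ ^ 2) -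
          (r * n₂ ^ 2 + 2 * h₂ * q₂ * n₂ + h₂ * q₂ ^ 2) := by
      linear_combination (-(n₁ + n₂)) * hl
    rw [heq]; exact hq

/-- (3·9) for either sign of `q₁`. [cite: RobertSargos2002, (3.9)] -/
theorem KCond.abs_d_le' {R Q H δ : ℝ} {r q₁ q₂ h₁ h₂ d : ℤ} (hc : KCond R Q H δ r q₁ q₂ h₁ h₂ d)
    (hRH : 2 * R ≤ H) : (|d| : ℝ) ≤ (δ + 8) * Q / 2 := by
  rcases lt_trichotomy q₁ 0 with h | h | h
  · have := hc.neg.abs_d_le hRH (by linarith)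
    push_cast at this; rwa [abs_neg] at this
  · exfalso
    have h1 := hc.q₁_ge; have h2 := hc.q₁_lt
    rw [h] at h1 h2; simp at h1 h2; linarith
  · exact hc.abs_d_le hRH h

/-- The projection `(r,q₁,q₂,h₁,h₂,n₁,n₂) ↦ (r,q₁,q₂,h₁,h₂,n₁-n₂)`. [folklore] -/
def psi : ℤ × ℤ × ℤ × ℤ × ℤ × ℤ × ℤ → ℤ × ℤ × ℤ × ℤ × ℤ × ℤ :=
  fun p => (p.1, p.2.1, p.2.2.1, p.2.2.2.1, p.2.2.2.2.1, p.2.2.2.2.2.1 - p.2.2.2.2.2.2)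

/-- **[RS] Lemma 6, first step**: `#S ≤ N · #ψ(S)` — given the sextuple, `n₂ ∈ [1, N]` determines
the septuple. [cite: RobertSargos2002, Lemma 6] -/
theorem card_le_N_mul_card_image {R Q H N δ : ℝ} (hN : 1 ≤ N)
    (S : Finset (ℤ × ℤ × ℤ × ℤ × ℤ × ℤ × ℤ))
    (hS : ∀ p ∈ S, NCond R Q H N δ p.1 p.2.1 p.2.2.1 p.2.2.2.1 p.2.2.2.2.1 p.2.2.2.2.2.1
      p.2.2.2.2.2.2) :
    (S.card : ℝ) ≤ (S.image psi).card * N := by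
  classical
  refine card_le_card_mul_of_fiber_le S psi (S.image psi) (fun p hp => Finset.mem_image_of_mem _ hp)
    fun t _ => ?_
  set F := S.filter fun p => psi p = t with hF
  have hinj : Set.InjOn (fun p : ℤ × ℤ × ℤ × ℤ × ℤ × ℤ × ℤ => p.2.2.2.2.2.2) F := by
    intro p hp p' hp' hpp
    rw [Finset.mem_coe, hF, Finset.mem_filter] at hp hp'
    have hee := hp.2.trans hp'.2.symm
    simp only [psi, Prod.mk.injEq] at hee
    obtain ⟨e1, e2, e3, e4, e5, e6⟩ := hee
    simp only at hpp
    have e7 : p.2.2.2.2.2.1 = p'.2.2.2.2.2.1 := by linarith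
    exact Prod.ext e1 (Prod.ext e2 (Prod.ext e3 (Prod.ext e4 (Prod.ext e5 (Prod.ext e7 hpp)))))
  rw [← Finset.card_image_of_injOn hinj]
  have := card_le_of_forall_mem_Icc (F.image fun p : ℤ × ℤ × ℤ × ℤ × ℤ × ℤ × ℤ => p.2.2.2.2.2.2)
    (x := 1) (L := N - 1) (by linarith) fun n hn => by
      obtain ⟨p, hp, rfl⟩ := Finset.mem_image.mp hn
      rw [hF, Finset.mem_filter] at hp
      have hc := hS p hp.1
      exact ⟨by exact_mod_cast hc.n₂_ge, by linarith [hc.n₂_le]⟩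
  linarith

/-! ### Lemma 6: the sextuples with `d = 0` -/

/-- **[RS] Lemma 6, `d = 0`**: sextuples satisfying (3·4), (3·8) with `d = 0` and `q₁ > 0` are
determined by `(r, h₁, q₁)` up to the `≤ τ(h₁q₁)` factorizations `h₂q₂ = h₁q₁ < 4HQ` ("using only
the first line of (3·2), the number of solutions with `d = 0` is `O_ε((RQHN)^{1+ε})`").
[cite: RobertSargos2002, Lemma 6] -/
theorem card_le_d_zero_pos {R Q H δ η Cη : ℝ} (hR : 1 ≤ R) (hQ : 1 ≤ Q) (hRH : 2 * R ≤ H)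
    (hη : 0 < η) (hCη : ∀ n : ℕ, n ≠ 0 → ((Nat.divisors n).card : ℝ) ≤ Cη * (n : ℝ) ^ η)
    (T : Finset (ℤ × ℤ × ℤ × ℤ × ℤ × ℤ))
    (hT : ∀ t ∈ T, KCond R Q H δ t.1 t.2.1 t.2.2.1 t.2.2.2.1 t.2.2.2.2.1 t.2.2.2.2.2 ∧ 0 < t.2.1 ∧
      t.2.2.2.2.2 = 0) :
    (T.card : ℝ) ≤ 60 * Cη * (4 * H * Q) ^ η * (R * H * Q) := by
  classical
  have hH : 0 < H := by linarith
  have hQ0 : 0 < Q := by linarith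
  set A : Finset (ℤ × ℤ × ℤ) :=
    (Finset.Icc (-⌈R⌉) ⌈R⌉) ×ˢ ((Finset.Icc 0 ⌈2 * H⌉) ×ˢ (Finset.Icc 0 ⌈2 * Q⌉)) with hAdef
  set f : ℤ × ℤ × ℤ × ℤ × ℤ × ℤ → ℤ × ℤ × ℤ := fun p => (p.1, p.2.2.2.1, p.2.1) with hf
  have hfA : ∀ p ∈ T, f p ∈ A := by
    intro p hp
    obtain ⟨hc, hq, _⟩ := hT p hp
    simp only [hf, hAdef, Finset.mem_product, Finset.mem_Icc]
    obtain ⟨h1, h2⟩ := hc.r_lt'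
    have h3 := hc.h₁_ge; have h4 := hc.h₁_lt
    have hq1R : (0 : ℝ) < p.2.1 := by exact_mod_cast hq
    have h5 : (p.2.1 : ℝ) < 2 * Q := by have := hc.q₁_lt; rwa [abs_of_pos hq1R] at this
    have hRc : R ≤ ⌈R⌉ := Int.le_ceil R
    have hHc : 2 * H ≤ ⌈2 * H⌉ := Int.le_ceil _
    have hQc : 2 * Q ≤ ⌈2 * Q⌉ := Int.le_ceil _
    refine ⟨⟨?_, ?_⟩, ⟨?_, ?_⟩, ⟨hq.le, ?_⟩⟩
    · have : (-⌈R⌉ : ℝ) ≤ p.1 := by linarith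
      exact_mod_cast this
    · have : (p.1 : ℝ) ≤ ⌈R⌉ := by linarith
      exact_mod_cast this
    · have : (0 : ℝ) ≤ p.2.2.2.1 := by linarith
      exact_mod_cast this
    · have : (p.2.2.2.1 : ℝ) ≤ ⌈2 * H⌉ := by linarith
      exact_mod_cast this
    · have : (p.2.1 : ℝ) ≤ ⌈2 * Q⌉ := by linarith
      exact_mod_cast this
  have hIcc : ∀ (a b : ℤ) (x : ℝ), (0 : ℝ) ≤ (b : ℝ) + 1 - a → ((b : ℝ) + 1 - a ≤ x) →
      (((Finset.Icc a b).card : ℕ) : ℝ) ≤ x := by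
    intro a b x h0 hx
    rw [Int.card_Icc]
    have h0' : (0 : ℤ) ≤ b + 1 - a := by exact_mod_cast h0
    have : (((b + 1 - a).toNat : ℤ) : ℝ) = ((b + 1 - a : ℤ) : ℝ) := by rw [Int.toNat_of_nonneg h0']
    rw [show ((b + 1 - a).toNat : ℝ) = (((b + 1 - a).toNat : ℤ) : ℝ) by norm_cast, this]
    push_cast; exact hx
  have hRc' := Int.ceil_lt_add_one R
  have hHc' := Int.ceil_lt_add_one (2 * H)
  have hQc' := Int.ceil_lt_add_one (2 * Q)
  have hR0 : (0 : ℝ) ≤ ⌈R⌉ := by exact_mod_cast Int.ceil_nonneg (by linarith : (0 : ℝ) ≤ R)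
  have hH0 : (0 : ℝ) ≤ ⌈2 * H⌉ := by exact_mod_cast Int.ceil_nonneg (by linarith : (0 : ℝ) ≤ 2 * H)
  have hQ0' : (0 : ℝ) ≤ ⌈2 * Q⌉ := by exact_mod_cast Int.ceil_nonneg (by linarith : (0 : ℝ) ≤ 2 * Q)
  have hA1 : (((Finset.Icc (-⌈R⌉) ⌈R⌉).card : ℕ) : ℝ) ≤ 5 * R :=
    hIcc _ _ _ (by push_cast; linarith) (by push_cast; linarith)
  have hA2 : (((Finset.Icc (0 : ℤ) ⌈2 * H⌉).card : ℕ) : ℝ) ≤ 3 * H :=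
    hIcc _ _ _ (by push_cast; linarith) (by push_cast; linarith)
  have hA3 : (((Finset.Icc (0 : ℤ) ⌈2 * Q⌉).card : ℕ) : ℝ) ≤ 4 * Q :=
    hIcc _ _ _ (by push_cast; linarith) (by push_cast; linarith)
  have hAcard : (A.card : ℝ) ≤ 5 * R * (3 * H) * (4 * Q) := by
    rw [hAdef, Finset.card_product, Finset.card_product]
    push_cast
    have := mul_le_mul hA2 hA3 (by positivity) (by positivity)
    have := mul_le_mul hA1 this (by positivity) (by positivity)
    linarith
  have hC0 : 0 ≤ Cη := by have := hCη 1 one_ne_zero; simp at this; linarith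
  have hfib : ∀ a ∈ A, ((T.filter fun p => f p = a).card : ℝ) ≤ Cη * (4 * H * Q) ^ η := by
    intro a _
    set F := T.filter fun p => f p = a with hF
    rcases F.eq_empty_or_nonempty with hFe | ⟨p₀, hp₀⟩
    · rw [hFe, Finset.card_empty, Nat.cast_zero]; positivity
    have hp₀T : p₀ ∈ T := (Finset.mem_filter.mp hp₀).1
    have hfp₀ : f p₀ = a := (Finset.mem_filter.mp hp₀).2
    obtain ⟨hc₀, hq₀, hd₀⟩ := hT p₀ hp₀T
    set v : ℤ := p₀.2.2.2.2.1 * p₀.2.2.1 with hv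
    have hq₂₀ := hc₀.q₂_pos hq₀
    have hh₂₀ := hc₀.h₂_pos hRH
    have hv0 : 0 < v := mul_pos hh₂₀ hq₂₀
    set g : ℤ × ℤ × ℤ × ℤ × ℤ × ℤ → ℤ × ℤ := fun p => (p.2.2.2.2.1, p.2.2.1) with hg
    have hinj : Set.InjOn g F := by
      intro p hp p' hp' hpp
      rw [Finset.mem_coe, hF, Finset.mem_filter] at hp hp'
      have hee := hp.2.trans hp'.2.symm
      simp only [hf, Prod.mk.injEq] at hee
      obtain ⟨e1, e2, e3⟩ := hee
      simp only [hg, Prod.mk.injEq] at hpp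
      obtain ⟨e5, e6⟩ := hpp
      have e4 : p.2.2.2.2.2 = p'.2.2.2.2.2 := by
        rw [(hT p hp.1).2.2, (hT p' hp'.1).2.2]
      exact Prod.ext e1 (Prod.ext e3 (Prod.ext e6 (Prod.ext e2 (Prod.ext e5 e4))))
    have hW : ∀ w ∈ F.image g, w.1 * w.2 = v ∧ 0 < w.2 := by
      intro w hw
      obtain ⟨p, hp, rfl⟩ := Finset.mem_image.mp hw
      rw [hF, Finset.mem_filter] at hp
      obtain ⟨hpT, hfp⟩ := hp
      obtain ⟨hc, hq, hd⟩ := hT p hpT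
      have hee := hfp.trans hfp₀.symm
      simp only [hf, Prod.mk.injEq] at hee
      obtain ⟨e1, e2, e3⟩ := hee
      refine ⟨?_, hc.q₂_pos hq⟩
      simp only [hg]
      have h1 := hc.lin
      have h2 := hc₀.lin
      rw [hd] at h1; rw [hd₀] at h2
      rw [hv]
      rw [e2, e3] at h1
      linear_combination h2 - h1
    have h1 : F.card ≤ (Nat.divisors v.natAbs).card := by
      rw [← Finset.card_image_of_injOn hinj]
      exact card_le_card_divisors hv0.ne' _ hW
    have h2 : ((Nat.divisors v.natAbs).card : ℝ) ≤ Cη * (v.natAbs : ℝ) ^ η :=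
      hCη _ (Int.natAbs_ne_zero.mpr hv0.ne')
    have h3 : (v.natAbs : ℝ) ≤ 4 * H * Q := by
      rw [Nat.cast_natAbs, Int.cast_abs, abs_of_pos (by exact_mod_cast hv0), hv]
      push_cast
      have hq2R : (0 : ℝ) < p₀.2.2.1 := by exact_mod_cast hq₂₀
      have hh2R : (0 : ℝ) < p₀.2.2.2.2.1 := by exact_mod_cast hh₂₀
      have hq₂Q : (p₀.2.2.1 : ℝ) < 2 * Q := by have := hc₀.q₂_lt; rwa [abs_of_pos hq2R] at this
      have hh₂H : (p₀.2.2.2.2.1 : ℝ) < 2 * H := hc₀.h₂_lt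
      nlinarith
    calc (F.card : ℝ) ≤ ((Nat.divisors v.natAbs).card : ℝ) := by exact_mod_cast h1
      _ ≤ Cη * (v.natAbs : ℝ) ^ η := h2
      _ ≤ Cη * (4 * H * Q) ^ η := by
          apply mul_le_mul_of_nonneg_left _ hC0
          exact Real.rpow_le_rpow (by positivity) h3 hη.le
  have h := card_le_card_mul_of_fiber_le T f A hfA hfib
  refine h.trans ?_
  calc (A.card : ℝ) * (Cη * (4 * H * Q) ^ η) ≤ (5 * R * (3 * H) * (4 * Q)) * (Cη * (4 * H * Q) ^ η) :=
        mul_le_mul_of_nonneg_right hAcard (by positivity)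
    _ = 60 * Cη * (4 * H * Q) ^ η * (R * H * Q) := by ring

/-- `d = 0`, both signs of `q₁`. [cite: RobertSargos2002, Lemma 6] -/
theorem card_le_d_zero {R Q H δ η Cη : ℝ} (hR : 1 ≤ R) (hQ : 1 ≤ Q) (hRH : 2 * R ≤ H)
    (hη : 0 < η) (hCη : ∀ n : ℕ, n ≠ 0 → ((Nat.divisors n).card : ℝ) ≤ Cη * (n : ℝ) ^ η)
    (T : Finset (ℤ × ℤ × ℤ × ℤ × ℤ × ℤ))
    (hT : ∀ t ∈ T, KCond R Q H δ t.1 t.2.1 t.2.2.1 t.2.2.2.1 t.2.2.2.2.1 t.2.2.2.2.2 ∧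
      t.2.2.2.2.2 = 0) :
    (T.card : ℝ) ≤ 120 * Cη * (4 * H * Q) ^ η * (R * H * Q) := by
  classical
  set Tp := T.filter fun p => 0 < p.2.1 with hTp
  set Tm := T.filter fun p => p.2.1 < 0 with hTm
  have hsub : T ⊆ Tp ∪ Tm := by
    intro p hp
    have hc := (hT p hp).1
    rw [Finset.mem_union, hTp, hTm, Finset.mem_filter, Finset.mem_filter]
    rcases lt_trichotomy p.2.1 0 with h | h | h
    · exact Or.inr ⟨hp, h⟩
    · exfalso
      have h1 := hc.q₁_ge; have h2 := hc.q₁_lt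
      rw [h] at h1 h2; simp at h1 h2; linarith
    · exact Or.inl ⟨hp, h⟩
  have hcard : T.card ≤ Tp.card + Tm.card :=
    (Finset.card_le_card hsub).trans (Finset.card_union_le _ _)
  have hTp_le := card_le_d_zero_pos hR hQ hRH hη hCη Tp fun p hp => by
    rw [hTp, Finset.mem_filter] at hp
    exact ⟨(hT p hp.1).1, hp.2, (hT p hp.1).2⟩
  have hTm_le : (Tm.card : ℝ) ≤ 60 * Cη * (4 * H * Q) ^ η * (R * H * Q) := by
    rw [← Finset.card_image_of_injective Tm negMap_injective]
    refine card_le_d_zero_pos (δ := δ) hR hQ hRH hη hCη _ fun t ht => ?_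
    obtain ⟨p, hp, rfl⟩ := Finset.mem_image.mp ht
    rw [hTm, Finset.mem_filter] at hp
    have hc := (hT p hp.1).1
    simp only [negMap]
    exact ⟨hc.neg, by linarith [hp.2], by rw [(hT p hp.1).2]; simp⟩
  have : (T.card : ℝ) ≤ Tp.card + Tm.card := by exact_mod_cast hcard
  linarith

/-! ### Lemma 6: the sextuples with `gcd(d, q₁, q₂) > Q` -/

/-- **[RS] Lemma 6, `k = gcd(d,q₁,q₂) > Q`**: then `q₁ = q₂ = ±k`, `d = q₁ e` with `|e| ≤ (δ+8)/2`
and `h₂ = h₁ + r e`, so these sextuples number at most `1260 RQH (1 + δ)` ("if we assume that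
`k = gcd(d,q₁,q₂)` is greater than `Q`, then we have `q₁ = q₂ = k` and there are `O(1+δ)`
possibilities for `d`"). [cite: RobertSargos2002, Lemma 6, (3.11)] -/
theorem card_le_gcd_large {R Q H δ : ℝ} (hR : 1 ≤ R) (hQ : 1 ≤ Q) (hRH : 2 * R ≤ H) (hδ : 0 < δ)
    (T : Finset (ℤ × ℤ × ℤ × ℤ × ℤ × ℤ))
    (hT : ∀ t ∈ T, KCond R Q H δ t.1 t.2.1 t.2.2.1 t.2.2.2.1 t.2.2.2.2.1 t.2.2.2.2.2 ∧
      t.2.2.2.2.2 ≠ 0 ∧ Q < (Int.gcd (Int.gcd t.2.2.2.2.2 t.2.1) t.2.2.1 : ℝ)) :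
    (T.card : ℝ) ≤ 1260 * (R * H * Q) * (1 + δ) := by
  classical
  have hH : 0 < H := by linarith
  have hQ0 : 0 < Q := by linarith
  -- structure of the elements of `T`
  have key : ∀ t ∈ T, t.2.2.1 = t.2.1 ∧ t.2.1 ∣ t.2.2.2.2.2 ∧
      t.2.2.2.2.1 = t.2.2.2.1 + t.1 * (t.2.2.2.2.2 / t.2.1) ∧
      (|((t.2.2.2.2.2 / t.2.1 : ℤ) : ℝ)|) ≤ (δ + 8) / 2 := by
    intro t ht
    obtain ⟨hc, hd, hkQ⟩ := hT t ht
    set k : ℕ := Int.gcd (Int.gcd t.2.2.2.2.2 t.2.1) t.2.2.1 with hk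
    have hkq₁ : (k : ℤ) ∣ t.2.1 :=
      (Int.gcd_dvd_left _ _).trans (Int.gcd_dvd_right t.2.2.2.2.2 t.2.1)
    have hkq₂ : (k : ℤ) ∣ t.2.2.1 := Int.gcd_dvd_right _ _
    have hkd : (k : ℤ) ∣ t.2.2.2.2.2 :=
      (Int.gcd_dvd_left _ _).trans (Int.gcd_dvd_left t.2.2.2.2.2 t.2.1)
    have hk0 : (0 : ℝ) < k := by linarith
    have hq₁0 : t.2.1 ≠ 0 := by
      intro h0; have := hc.q₁_ge; rw [h0] at this; simp at this; linarith
    -- `|q₁| = k = |q₂|`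
    have habs : ∀ q : ℤ, (k : ℤ) ∣ q → Q ≤ |(q : ℝ)| → |(q : ℝ)| < 2 * Q → q = k ∨ q = -k := by
      intro q hkq hQq hq2
      obtain ⟨a, ha⟩ := hkq
      have ha0 : a ≠ 0 := by rintro rfl; rw [mul_zero] at ha; rw [ha] at hQq; simp at hQq; linarith
      have h1 : |(q : ℝ)| = k * |(a : ℝ)| := by
        rw [ha]; push_cast; rw [abs_mul, abs_of_nonneg hk0.le]
      have h2 : |(a : ℝ)| < 2 := by
        have : (k : ℝ) * |(a : ℝ)| < 2 * Q := h1 ▸ hq2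
        nlinarith [abs_nonneg (a : ℝ)]
      have h3 : (1 : ℝ) ≤ |(a : ℝ)| := by
        have : (1 : ℤ) ≤ |a| := Int.one_le_abs ha0
        have h' : ((1 : ℤ) : ℝ) ≤ ((|a| : ℤ) : ℝ) := by exact_mod_cast this
        simpa [Int.cast_abs] using h'
      have h4 : |a| = 1 := by
        have h5 : |a| < 2 := by
          have : ((|a| : ℤ) : ℝ) < 2 := by rw [Int.cast_abs]; exact h2
          exact_mod_cast this
        have h6 : (1 : ℤ) ≤ |a| := Int.one_le_abs ha0
        omega
      rcases (abs_eq (zero_le_one)).mp h4 with h | h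
      · left; rw [ha, h, mul_one]
      · right; rw [ha, h, mul_neg_one]
    have hq₁ := habs t.2.1 hkq₁ hc.q₁_ge hc.q₁_lt
    have hq₂ := habs t.2.2.1 hkq₂ hc.q₂_ge hc.q₂_lt
    have hqq := hc.qq
    have hk0' : (0 : ℤ) < k := by exact_mod_cast (show (0:ℝ) < k from hk0)
    have heq : t.2.2.1 = t.2.1 := by
      rcases hq₁ with h1 | h1 <;> rcases hq₂ with h2 | h2
      · rw [h1, h2]
      · rw [h1, h2] at hqq; nlinarith
      · rw [h1, h2] at hqq; nlinarith
      · rw [h1, h2]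
    -- `q₁ ∣ d`
    have hdvd : t.2.1 ∣ t.2.2.2.2.2 := by
      rcases hq₁ with h1 | h1
      · rw [h1]; exact hkd
      · rw [h1]; exact (neg_dvd).mpr hkd
    refine ⟨heq, hdvd, ?_, ?_⟩
    · -- from the first line of (3·8)
      have hl := hc.lin
      rw [heq] at hl
      have hde : t.2.1 * (t.2.2.2.2.2 / t.2.1) = t.2.2.2.2.2 := Int.mul_ediv_cancel' hdvd
      have : t.2.1 * (t.2.2.2.2.1 - t.2.2.2.1 - t.1 * (t.2.2.2.2.2 / t.2.1)) = 0 := by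
        linear_combination -hl - t.1 * hde
      rcases mul_eq_zero.mp this with h0 | h0
      · exact absurd h0 hq₁0
      · linarith
    · -- `|e| = |d| / k ≤ (δ+8)Q/(2k) < (δ+8)/2`
      have hdle := hc.abs_d_le' hRH
      have hde : t.2.1 * (t.2.2.2.2.2 / t.2.1) = t.2.2.2.2.2 := Int.mul_ediv_cancel' hdvd
      have hqabs : |(t.2.1 : ℝ)| = k := by
        rcases hq₁ with h1 | h1 <;> rw [h1] <;> push_cast
        · exact abs_of_nonneg hk0.le
        · rw [abs_neg]; exact abs_of_nonneg hk0.le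
      have h1 : |(t.2.2.2.2.2 : ℝ)| = k * |((t.2.2.2.2.2 / t.2.1 : ℤ) : ℝ)| := by
        rw [← hqabs, ← abs_mul]; congr 1; exact_mod_cast hde.symm
      rw [h1] at hdle
      -- `k |e| ≤ (δ+8)Q/2` and `Q < k`
      by_contra hcon
      rw [not_le] at hcon
      have : (δ + 8) * Q / 2 < k * |((t.2.2.2.2.2 / t.2.1 : ℤ) : ℝ)| := by
        calc (δ + 8) * Q / 2 = Q * ((δ + 8) / 2) := by ring
          _ < k * ((δ + 8) / 2) := by gcongr
          _ ≤ k * |((t.2.2.2.2.2 / t.2.1 : ℤ) : ℝ)| := by gcongr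
      linarith
  -- the injection `t ↦ (r, q₁, h₁, d/q₁)`
  set Dm : ℤ := ⌈(δ + 8) / 2⌉ with hDm
  set A : Finset (ℤ × ℤ × ℤ × ℤ) := (Finset.Icc (-⌈R⌉) ⌈R⌉) ×ˢ ((Finset.Icc (-⌈2 * Q⌉) ⌈2 * Q⌉) ×ˢ
    ((Finset.Icc 0 ⌈2 * H⌉) ×ˢ (Finset.Icc (-Dm) Dm))) with hAdef
  set f : ℤ × ℤ × ℤ × ℤ × ℤ × ℤ → ℤ × ℤ × ℤ × ℤ :=
    fun p => (p.1, p.2.1, p.2.2.2.1, p.2.2.2.2.2 / p.2.1) with hf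
  have hinj : Set.InjOn f T := by
    intro p hp p' hp' hpp
    obtain ⟨k1, k2, k3, _⟩ := key p hp
    obtain ⟨k1', k2', k3', _⟩ := key p' hp'
    simp only [hf, Prod.mk.injEq] at hpp
    obtain ⟨e1, e2, e4, ee⟩ := hpp
    have e3 : p.2.2.1 = p'.2.2.1 := by rw [k1, k1', e2]
    have e6 : p.2.2.2.2.2 = p'.2.2.2.2.2 := by
      rw [← Int.mul_ediv_cancel' k2, ← Int.mul_ediv_cancel' k2', ee, e2]
    have e5 : p.2.2.2.2.1 = p'.2.2.2.2.1 := by rw [k3, k3', e4, e1, ee]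
    exact Prod.ext e1 (Prod.ext e2 (Prod.ext e3 (Prod.ext e4 (Prod.ext e5 e6))))
  have hfA : ∀ p ∈ T, f p ∈ A := by
    intro p hp
    obtain ⟨hc, _, _⟩ := hT p hp
    obtain ⟨_, _, _, k4⟩ := key p hp
    simp only [hf, hAdef, Finset.mem_product, Finset.mem_Icc]
    obtain ⟨h1, h2⟩ := hc.r_lt'
    have h3 := hc.h₁_ge; have h4 := hc.h₁_lt
    obtain ⟨h5, h6⟩ := abs_lt.mp hc.q₁_lt
    have hRc : R ≤ ⌈R⌉ := Int.le_ceil R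
    have hHc : 2 * H ≤ ⌈2 * H⌉ := Int.le_ceil _
    have hQc : 2 * Q ≤ ⌈2 * Q⌉ := Int.le_ceil _
    have hDc : (δ + 8) / 2 ≤ Dm := Int.le_ceil _
    obtain ⟨h7, h8⟩ := abs_le.mp k4
    refine ⟨⟨?_, ?_⟩, ⟨?_, ?_⟩, ⟨?_, ?_⟩, ⟨?_, ?_⟩⟩
    · have : (-⌈R⌉ : ℝ) ≤ p.1 := by linarith
      exact_mod_cast this
    · have : (p.1 : ℝ) ≤ ⌈R⌉ := by linarith
      exact_mod_cast this
    · have : (-⌈2 * Q⌉ : ℝ) ≤ p.2.1 := by linarith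
      exact_mod_cast this
    · have : (p.2.1 : ℝ) ≤ ⌈2 * Q⌉ := by linarith
      exact_mod_cast this
    · have : (0 : ℝ) ≤ p.2.2.2.1 := by linarith
      exact_mod_cast this
    · have : (p.2.2.2.1 : ℝ) ≤ ⌈2 * H⌉ := by linarith
      exact_mod_cast this
    · have : (-Dm : ℝ) ≤ ((p.2.2.2.2.2 / p.2.1 : ℤ) : ℝ) := by linarith
      exact_mod_cast this
    · have : ((p.2.2.2.2.2 / p.2.1 : ℤ) : ℝ) ≤ Dm := by linarith
      exact_mod_cast this
  have hIcc : ∀ (a b : ℤ) (x : ℝ), (0 : ℝ) ≤ (b : ℝ) + 1 - a → ((b : ℝ) + 1 - a ≤ x) →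
      (((Finset.Icc a b).card : ℕ) : ℝ) ≤ x := by
    intro a b x h0 hx
    rw [Int.card_Icc]
    have h0' : (0 : ℤ) ≤ b + 1 - a := by exact_mod_cast h0
    have : (((b + 1 - a).toNat : ℤ) : ℝ) = ((b + 1 - a : ℤ) : ℝ) := by rw [Int.toNat_of_nonneg h0']
    rw [show ((b + 1 - a).toNat : ℝ) = (((b + 1 - a).toNat : ℤ) : ℝ) by norm_cast, this]
    push_cast; exact hx
  have hRc' := Int.ceil_lt_add_one R
  have hHc' := Int.ceil_lt_add_one (2 * H)
  have hQc' := Int.ceil_lt_add_one (2 * Q)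
  have hDc' := Int.ceil_lt_add_one ((δ + 8) / 2)
  have hR0 : (0 : ℝ) ≤ ⌈R⌉ := by exact_mod_cast Int.ceil_nonneg (by linarith : (0 : ℝ) ≤ R)
  have hH0 : (0 : ℝ) ≤ ⌈2 * H⌉ := by exact_mod_cast Int.ceil_nonneg (by linarith : (0 : ℝ) ≤ 2 * H)
  have hQ0' : (0 : ℝ) ≤ ⌈2 * Q⌉ := by exact_mod_cast Int.ceil_nonneg (by linarith : (0 : ℝ) ≤ 2 * Q)
  have hD0 : (0 : ℝ) ≤ Dm := by
    have : (0 : ℝ) ≤ (δ + 8) / 2 := by positivity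
    exact_mod_cast Int.ceil_nonneg this
  have hA1 : (((Finset.Icc (-⌈R⌉) ⌈R⌉).card : ℕ) : ℝ) ≤ 5 * R :=
    hIcc _ _ _ (by push_cast; linarith) (by push_cast; linarith)
  have hA2 : (((Finset.Icc (-⌈2 * Q⌉) ⌈2 * Q⌉).card : ℕ) : ℝ) ≤ 7 * Q :=
    hIcc _ _ _ (by push_cast; linarith) (by push_cast; linarith)
  have hA3 : (((Finset.Icc (0 : ℤ) ⌈2 * H⌉).card : ℕ) : ℝ) ≤ 3 * H :=
    hIcc _ _ _ (by push_cast; linarith) (by push_cast; linarith)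
  have hA4 : (((Finset.Icc (-Dm) Dm).card : ℕ) : ℝ) ≤ 12 * (1 + δ) := by
    refine hIcc _ _ _ (by push_cast; linarith) ?_
    push_cast
    have : (Dm : ℝ) < (δ + 8) / 2 + 1 := hDc'
    linarith
  have hAcard : (A.card : ℝ) ≤ 5 * R * ((7 * Q) * ((3 * H) * (12 * (1 + δ)))) := by
    rw [hAdef, Finset.card_product, Finset.card_product, Finset.card_product]
    push_cast
    have := mul_le_mul hA3 hA4 (by positivity) (by positivity)
    have := mul_le_mul hA2 this (by positivity) (by positivity)
    exact mul_le_mul hA1 this (by positivity) (by positivity)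
  have h := Finset.card_le_card_of_injOn f hfA hinj
  have h' : (T.card : ℝ) ≤ A.card := by exact_mod_cast h
  refine h'.trans (hAcard.trans (le_of_eq ?_))
  ring

/-! ### Lemma 6: division by the gcds -/

/-- **[RS] Lemma 6, the reduction to coprime variables**: dividing `(r, h₁, h₂)` by
`j = gcd(r,h₁,h₂)` and `(d, q₁, q₂)` by `k = gcd(d,q₁,q₂)` ("we may divide the first line of (3·5)
by `jk` and the second line of (3·5) by `jk²`") maps a sextuple satisfying (3·4), (3·8) with
`d ≠ 0` to one of `𝒥(R/j, Q/k, H/j, δ)`. [cite: RobertSargos2002, Lemma 6, (3.7)] -/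
theorem JCond_div {R Q H δ : ℝ} {r q₁ q₂ h₁ h₂ d : ℤ} (hc : KCond R Q H δ r q₁ q₂ h₁ h₂ d)
    (hd : d ≠ 0) :
    JCond (R / (Int.gcd (Int.gcd r h₁) h₂)) (Q / (Int.gcd (Int.gcd d q₁) q₂))
      (H / (Int.gcd (Int.gcd r h₁) h₂)) δ
      (r / (Int.gcd (Int.gcd r h₁) h₂)) (q₁ / (Int.gcd (Int.gcd d q₁) q₂))
      (q₂ / (Int.gcd (Int.gcd d q₁) q₂)) (h₁ / (Int.gcd (Int.gcd r h₁) h₂))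
      (h₂ / (Int.gcd (Int.gcd r h₁) h₂)) (d / (Int.gcd (Int.gcd d q₁) q₂)) := by
  set j : ℕ := Int.gcd (Int.gcd r h₁) h₂ with hj
  set k : ℕ := Int.gcd (Int.gcd d q₁) q₂ with hk
  -- positivity and divisibility
  have hj0 : 0 < j := by
    rw [hj]; apply Int.gcd_pos_of_ne_zero_left
    exact_mod_cast (Int.gcd_pos_of_ne_zero_left h₁ hc.r_ne).ne'
  have hk0 : 0 < k := by
    rw [hk]; apply Int.gcd_pos_of_ne_zero_left
    exact_mod_cast (Int.gcd_pos_of_ne_zero_left q₁ hd).ne'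
  have hjZ : (j : ℤ) ≠ 0 := by exact_mod_cast hj0.ne'
  have hkZ : (k : ℤ) ≠ 0 := by exact_mod_cast hk0.ne'
  have hjR : (0 : ℝ) < j := by exact_mod_cast hj0
  have hkR : (0 : ℝ) < k := by exact_mod_cast hk0
  have hjr : (j : ℤ) ∣ r := (Int.gcd_dvd_left _ _).trans (Int.gcd_dvd_left r h₁)
  have hjh₁ : (j : ℤ) ∣ h₁ := (Int.gcd_dvd_left _ _).trans (Int.gcd_dvd_right r h₁)
  have hjh₂ : (j : ℤ) ∣ h₂ := Int.gcd_dvd_right _ _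
  have hkd : (k : ℤ) ∣ d := (Int.gcd_dvd_left _ _).trans (Int.gcd_dvd_left d q₁)
  have hkq₁ : (k : ℤ) ∣ q₁ := (Int.gcd_dvd_left _ _).trans (Int.gcd_dvd_right d q₁)
  have hkq₂ : (k : ℤ) ∣ q₂ := Int.gcd_dvd_right _ _
  -- the quotients
  set r' := r / j with hr'
  set h₁' := h₁ / j with hh₁'
  set h₂' := h₂ / j with hh₂'
  set d' := d / k with hd'
  set q₁' := q₁ / k with hq₁'
  set q₂' := q₂ / k with hq₂'
  have er : r = j * r' := (Int.mul_ediv_cancel' hjr).symm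
  have eh₁ : h₁ = j * h₁' := (Int.mul_ediv_cancel' hjh₁).symm
  have eh₂ : h₂ = j * h₂' := (Int.mul_ediv_cancel' hjh₂).symm
  have ed : d = k * d' := (Int.mul_ediv_cancel' hkd).symm
  have eq₁ : q₁ = k * q₁' := (Int.mul_ediv_cancel' hkq₁).symm
  have eq₂ : q₂ = k * q₂' := (Int.mul_ediv_cancel' hkq₂).symm
  -- real versions
  have err : (r : ℝ) = j * r' := by exact_mod_cast er
  have erh₁ : (h₁ : ℝ) = j * h₁' := by exact_mod_cast eh₁
  have erh₂ : (h₂ : ℝ) = j * h₂' := by exact_mod_cast eh₂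
  have erd : (d : ℝ) = k * d' := by exact_mod_cast ed
  have erq₁ : (q₁ : ℝ) = k * q₁' := by exact_mod_cast eq₁
  have erq₂ : (q₂ : ℝ) = k * q₂' := by exact_mod_cast eq₂
  refine
    { r_ne := ?_, r_lt := ?_, q₁_ge := ?_, q₁_lt := ?_, q₂_ge := ?_, q₂_lt := ?_, qq := ?_,
      h₁_ge := ?_, h₁_lt := ?_, h₂_ge := ?_, h₂_lt := ?_, lin := ?_, quad := ?_,
      d_ne := ?_, gcd_dq := ?_, gcd_rh := ?_ }
  · intro h0; apply hc.r_ne; rw [er, h0, mul_zero]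
  · have := hc.r_lt
    rw [err, abs_mul, abs_of_pos hjR] at this
    rw [lt_div_iff₀ hjR]; linarith
  · have := hc.q₁_ge
    rw [erq₁, abs_mul, abs_of_pos hkR] at this
    rw [div_le_iff₀ hkR]; linarith
  · have := hc.q₁_lt
    rw [erq₁, abs_mul, abs_of_pos hkR] at this
    rw [show 2 * (Q / (k : ℝ)) = 2 * Q / k by ring, lt_div_iff₀ hkR]; linarith
  · have := hc.q₂_ge
    rw [erq₂, abs_mul, abs_of_pos hkR] at this
    rw [div_le_iff₀ hkR]; linarith
  · have := hc.q₂_lt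
    rw [erq₂, abs_mul, abs_of_pos hkR] at this
    rw [show 2 * (Q / (k : ℝ)) = 2 * Q / k by ring, lt_div_iff₀ hkR]; linarith
  · have h := hc.qq
    rw [eq₁, eq₂, show (k : ℤ) * q₁' * (k * q₂') = ((k : ℤ) * k) * (q₁' * q₂') by ring] at h
    have hkk : (0 : ℤ) < (k : ℤ) * k := by positivity
    exact (mul_pos_iff_of_pos_left hkk).mp h
  · have := hc.h₁_ge
    rw [erh₁] at this
    rw [div_le_iff₀ hjR]; linarith
  · have := hc.h₁_lt
    rw [erh₁] at this
    rw [show 2 * (H / (j : ℝ)) = 2 * H / j by ring, lt_div_iff₀ hjR]; linarith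
  · have := hc.h₂_ge
    rw [erh₂] at this
    rw [div_le_iff₀ hjR]; linarith
  · have := hc.h₂_lt
    rw [erh₂] at this
    rw [show 2 * (H / (j : ℝ)) = 2 * H / j by ring, lt_div_iff₀ hjR]; linarith
  · have h := hc.lin
    rw [er, ed, eh₁, eq₁, eh₂, eq₂] at h
    have : ((j : ℤ) * k) * (r' * d' + h₁' * q₁' - h₂' * q₂') = 0 := by linear_combination h
    rcases mul_eq_zero.mp this with h0 | h0
    · exfalso; exact mul_ne_zero hjZ hkZ h0
    · exact h0
  · have h := hc.quad
    have heq : (h₁ * q₁ + h₂ * q₂) * d + h₁ * q₁ ^ 2 - h₂ * q₂ ^ 2 =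
        ((j : ℤ) * k ^ 2) * ((h₁' * q₁' + h₂' * q₂') * d' + h₁' * q₁' ^ 2 - h₂' * q₂' ^ 2) := by
      rw [eh₁, eh₂, ed, eq₁, eq₂]; ring
    rw [heq] at h
    push_cast at h ⊢
    rw [abs_mul, abs_of_pos (by positivity : (0 : ℝ) < (j : ℝ) * (k : ℝ) ^ 2)] at h
    rw [show δ * (H / j) * (Q / k) ^ 2 = δ * H * Q ^ 2 / (j * k ^ 2) by field_simp,
      le_div_iff₀ (by positivity)]
    linarith
  · intro h0; apply hd; rw [ed, h0, mul_zero]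
  · -- `gcd(gcd(d', q₁'), q₂') = 1`
    have hkg' : (k : ℤ) ∣ (Int.gcd d q₁ : ℤ) := by rw [hk]; exact Int.gcd_dvd_left _ _
    have h1 : Int.gcd d' q₁' = Int.gcd d q₁ / k := by
      rw [hd', hq₁', Int.gcd_div hkd hkq₁, Int.natAbs_natCast]
    have h2 : ((Int.gcd d' q₁' : ℕ) : ℤ) = (Int.gcd d q₁ : ℤ) / k := by
      rw [h1, Int.natCast_div]
    rw [h2, hq₂', Int.gcd_div hkg' hkq₂, Int.natAbs_natCast, ← hk]
    exact Nat.div_self hk0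
  · have hjg' : (j : ℤ) ∣ (Int.gcd r h₁ : ℤ) := by rw [hj]; exact Int.gcd_dvd_left _ _
    have h1 : Int.gcd r' h₁' = Int.gcd r h₁ / j := by
      rw [hr', hh₁', Int.gcd_div hjr hjh₁, Int.natAbs_natCast]
    have h2 : ((Int.gcd r' h₁' : ℕ) : ℤ) = (Int.gcd r h₁ : ℤ) / j := by
      rw [h1, Int.natCast_div]
    rw [h2, hh₂', Int.gcd_div hjg' hjh₂, Int.natAbs_natCast, ← hj]
    exact Nat.div_self hj0

/-! ### Lemma 6: the sextuples with `gcd(d, q₁, q₂) ≤ Q`, via Lemma 7 -/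

/-- `∑_{j=1}^{J} 1/j² ≤ 2 - 1/J ≤ 2`. [folklore] -/
theorem sum_inv_sq_le {J : ℕ} (hJ : 1 ≤ J) :
    ∑ j ∈ Finset.Icc 1 J, (1 : ℝ) / (j : ℝ) ^ 2 ≤ 2 - 1 / J := by
  induction J, hJ using Nat.le_induction with
  | base => simp; norm_num
  | succ n hn ih =>
    rw [Finset.sum_Icc_succ_top (by omega), Nat.cast_succ]
    have hn0 : (0 : ℝ) < n := by exact_mod_cast hn
    have hstep : 1 / ((n : ℝ) + 1) ^ 2 ≤ 1 / n - 1 / (n + 1) := by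
      rw [div_sub_div _ _ hn0.ne' (by positivity), div_le_div_iff₀ (by positivity) (by positivity)]
      nlinarith
    linarith

/-- The map dividing `(r, h₁, h₂)` by `j` and `(d, q₁, q₂)` by `k`. [folklore] -/
def divMap (b : ℕ × ℕ) : ℤ × ℤ × ℤ × ℤ × ℤ × ℤ → ℤ × ℤ × ℤ × ℤ × ℤ × ℤ :=
  fun p => (p.1 / b.1, p.2.1 / b.2, p.2.2.1 / b.2, p.2.2.2.1 / b.1, p.2.2.2.2.1 / b.1,
    p.2.2.2.2.2 / b.2)

/-- The pair of gcds `(gcd(r,h₁,h₂), gcd(d,q₁,q₂))`. [folklore] -/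
def gcdPair : ℤ × ℤ × ℤ × ℤ × ℤ × ℤ → ℕ × ℕ :=
  fun p => (Int.gcd (Int.gcd p.1 p.2.2.2.1) p.2.2.2.2.1, Int.gcd (Int.gcd p.2.2.2.2.2 p.2.1) p.2.2.1)

/-- **[RS] Lemma 6, the main class `1 ≤ gcd(d,q₁,q₂) ≤ Q`**, summed over `j = gcd(r,h₁,h₂) ≤ R`,
`k = gcd(d,q₁,q₂) ≤ Q` with Lemma 7 for `𝒥(R/j, Q/k, H/j, δ)`:
`# ≤ 41600 C_η(4HQ)^η RHQ (1 + Qδ)(1 + log(9Q/2))(1 + log Q)` (the factor `∑ 1/(j²k) ≤ 2(1 + log Q)`).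
[cite: RobertSargos2002, Lemma 6, (3.7), (3.11)] -/
theorem card_le_gcd_small {R Q H δ η Cη : ℝ} (hR : 1 ≤ R) (hQ : 1 ≤ Q) (hRH : 2 * R ≤ H)
    (hδ : 0 < δ) (hη : 0 < η) (hCη1 : 1 ≤ Cη)
    (hCη : ∀ n : ℕ, n ≠ 0 → ((Nat.divisors n).card : ℝ) ≤ Cη * (n : ℝ) ^ η)
    (T : Finset (ℤ × ℤ × ℤ × ℤ × ℤ × ℤ))
    (hT : ∀ t ∈ T, KCond R Q H δ t.1 t.2.1 t.2.2.1 t.2.2.2.1 t.2.2.2.2.1 t.2.2.2.2.2 ∧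
      t.2.2.2.2.2 ≠ 0 ∧ (Int.gcd (Int.gcd t.2.2.2.2.2 t.2.1) t.2.2.1 : ℝ) ≤ Q) :
    (T.card : ℝ) ≤ 41600 * (Cη * (4 * H * Q) ^ η) * (R * H * Q) * (1 + Q * δ) *
      (1 + Real.log (9 * Q / 2)) * (1 + Real.log Q) := by
  classical
  have hH : 0 < H := by linarith
  have hQ0 : 0 < Q := by linarith
  have hR0 : 0 < R := by linarith
  set W : ℝ := Cη * (4 * H * Q) ^ η with hW
  set ℓ : ℝ := 1 + Real.log (9 * Q / 2) with hℓ
  have hℓ1 : 1 ≤ ℓ := one_le_one_add_log hQ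
  set M : ℝ := 20800 * W * (R * H * Q) * (1 + Q * δ) * ℓ with hM
  have hW0 : 0 ≤ W := by positivity
  have hM0 : 0 ≤ M := by positivity
  -- the fibers over `(j, k)`
  set B : Finset (ℕ × ℕ) := (Finset.Icc 1 ⌈R⌉₊) ×ˢ (Finset.Icc 1 ⌊Q⌋₊) with hBdef
  have hGB : ∀ t ∈ T, gcdPair t ∈ B := by
    intro t ht
    obtain ⟨hc, hd, hkQ⟩ := hT t ht
    simp only [gcdPair, hBdef, Finset.mem_product, Finset.mem_Icc]
    have hj0 : 0 < Int.gcd (Int.gcd t.1 t.2.2.2.1) t.2.2.2.2.1 := by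
      apply Int.gcd_pos_of_ne_zero_left
      exact_mod_cast (Int.gcd_pos_of_ne_zero_left t.2.2.2.1 hc.r_ne).ne'
    have hk0 : 0 < Int.gcd (Int.gcd t.2.2.2.2.2 t.2.1) t.2.2.1 := by
      apply Int.gcd_pos_of_ne_zero_left
      exact_mod_cast (Int.gcd_pos_of_ne_zero_left t.2.1 hd).ne'
    refine ⟨⟨hj0, ?_⟩, ⟨hk0, Nat.le_floor hkQ⟩⟩
    -- `j ≤ |r| < R ≤ ⌈R⌉₊`
    have hjr : (Int.gcd (Int.gcd t.1 t.2.2.2.1) t.2.2.2.2.1 : ℤ) ∣ t.1 :=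
      (Int.gcd_dvd_left _ _).trans (Int.gcd_dvd_left _ _)
    have h1 : Int.gcd (Int.gcd t.1 t.2.2.2.1) t.2.2.2.2.1 ≤ t.1.natAbs :=
      Nat.le_of_dvd (Int.natAbs_pos.mpr hc.r_ne) (Int.natCast_dvd.mp hjr)
    have h2 : ((Int.gcd (Int.gcd t.1 t.2.2.2.1) t.2.2.2.2.1 : ℕ) : ℝ) ≤ |(t.1 : ℝ)| := by
      have : ((t.1.natAbs : ℕ) : ℝ) = |(t.1 : ℝ)| := by
        rw [Nat.cast_natAbs, Int.cast_abs]
      rw [← this]; exact_mod_cast h1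
    have h3 := hc.r_lt
    have h4 : ((Int.gcd (Int.gcd t.1 t.2.2.2.1) t.2.2.2.2.1 : ℕ) : ℝ) ≤ ⌈R⌉₊ := by
      have := Nat.le_ceil R; linarith
    exact_mod_cast h4
  -- bound for one fiber
  have hfib : ∀ bb ∈ B, ((T.filter fun t => gcdPair t = bb).card : ℝ) ≤
      M * (1 / ((bb.1 : ℝ) ^ 2 * bb.2)) := by
    intro bb hbb
    set F := T.filter fun t => gcdPair t = bb with hF
    have hbb' : 1 ≤ bb.1 ∧ 1 ≤ bb.2 := by
      simp only [hBdef, Finset.mem_product, Finset.mem_Icc] at hbb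
      exact ⟨hbb.1.1, hbb.2.1⟩
    have hj1 : (1 : ℝ) ≤ bb.1 := by exact_mod_cast hbb'.1
    have hk1 : (1 : ℝ) ≤ bb.2 := by exact_mod_cast hbb'.2
    rcases F.eq_empty_or_nonempty with hFe | ⟨t₀, ht₀⟩
    · rw [hFe, Finset.card_empty, Nat.cast_zero]; positivity
    -- parameters of the reduced problem
    set R' : ℝ := R / bb.1 with hR'
    set Q' : ℝ := Q / bb.2 with hQ'
    set H' : ℝ := H / bb.1 with hH'
    have ht₀T : t₀ ∈ T := (Finset.mem_filter.mp ht₀).1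
    have hg₀ : gcdPair t₀ = bb := (Finset.mem_filter.mp ht₀).2
    obtain ⟨hc₀, hd₀, hkQ₀⟩ := hT t₀ ht₀T
    have hjR : (bb.1 : ℝ) < R := by
      -- `j ≤ |r₀| < R`
      have hjr : (Int.gcd (Int.gcd t₀.1 t₀.2.2.2.1) t₀.2.2.2.2.1 : ℤ) ∣ t₀.1 :=
        (Int.gcd_dvd_left _ _).trans (Int.gcd_dvd_left _ _)
      have h1 : Int.gcd (Int.gcd t₀.1 t₀.2.2.2.1) t₀.2.2.2.2.1 ≤ t₀.1.natAbs :=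
        Nat.le_of_dvd (Int.natAbs_pos.mpr hc₀.r_ne) (Int.natCast_dvd.mp hjr)
      have h2 : ((Int.gcd (Int.gcd t₀.1 t₀.2.2.2.1) t₀.2.2.2.2.1 : ℕ) : ℝ) ≤ |(t₀.1 : ℝ)| := by
        have : ((t₀.1.natAbs : ℕ) : ℝ) = |(t₀.1 : ℝ)| := by rw [Nat.cast_natAbs, Int.cast_abs]
        rw [← this]; exact_mod_cast h1
      have h3 : (gcdPair t₀).1 = bb.1 := by rw [hg₀]
      simp only [gcdPair] at h3
      rw [h3] at h2
      linarith [hc₀.r_lt]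
    have hkQ : (bb.2 : ℝ) ≤ Q := by
      have h3 : (gcdPair t₀).2 = bb.2 := by rw [hg₀]
      simp only [gcdPair] at h3
      rw [h3] at hkQ₀; exact hkQ₀
    have hR'1 : 1 ≤ R' := by rw [hR', le_div_iff₀ (by linarith)]; linarith
    have hQ'1 : 1 ≤ Q' := by rw [hQ', le_div_iff₀ (by linarith)]; linarith
    have hRH' : 2 * R' ≤ H' := by
      rw [hR', hH', show 2 * (R / (bb.1 : ℝ)) = 2 * R / bb.1 by ring]
      exact div_le_div_of_nonneg_right hRH (by linarith)
    -- the division map is injective on the fiber and lands in `𝒥(R', Q', H', δ)`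
    have hinj : Set.InjOn (divMap bb) F := by
      intro p hp p' hp' hpp
      rw [Finset.mem_coe, hF, Finset.mem_filter] at hp hp'
      have hgp : gcdPair p = bb := hp.2
      have hgp' : gcdPair p' = bb := hp'.2
      have hgp1 : Int.gcd (Int.gcd p.1 p.2.2.2.1) p.2.2.2.2.1 = bb.1 := congrArg Prod.fst hgp
      have hgp2 : Int.gcd (Int.gcd p.2.2.2.2.2 p.2.1) p.2.2.1 = bb.2 := congrArg Prod.snd hgp
      have hgp1' : Int.gcd (Int.gcd p'.1 p'.2.2.2.1) p'.2.2.2.2.1 = bb.1 := congrArg Prod.fst hgp'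
      have hgp2' : Int.gcd (Int.gcd p'.2.2.2.2.2 p'.2.1) p'.2.2.1 = bb.2 := congrArg Prod.snd hgp'
      simp only [divMap, Prod.mk.injEq] at hpp
      obtain ⟨e1, e2, e3, e4, e5, e6⟩ := hpp
      -- divisibility
      have dv : ∀ (x y z : ℤ), ((Int.gcd (Int.gcd x y) z : ℕ) : ℤ) ∣ x ∧
          ((Int.gcd (Int.gcd x y) z : ℕ) : ℤ) ∣ y ∧ ((Int.gcd (Int.gcd x y) z : ℕ) : ℤ) ∣ z :=
        fun x y z => ⟨(Int.gcd_dvd_left _ _).trans (Int.gcd_dvd_left x y),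
          (Int.gcd_dvd_left _ _).trans (Int.gcd_dvd_right x y), Int.gcd_dvd_right _ _⟩
      obtain ⟨d1, d4, d5⟩ := dv p.1 p.2.2.2.1 p.2.2.2.2.1
      obtain ⟨d6, d2, d3⟩ := dv p.2.2.2.2.2 p.2.1 p.2.2.1
      obtain ⟨d1', d4', d5'⟩ := dv p'.1 p'.2.2.2.1 p'.2.2.2.2.1
      obtain ⟨d6', d2', d3'⟩ := dv p'.2.2.2.2.2 p'.2.1 p'.2.2.1
      rw [hgp1] at d1 d4 d5
      rw [hgp2] at d6 d2 d3
      rw [hgp1'] at d1' d4' d5'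
      rw [hgp2'] at d6' d2' d3'
      have canc : ∀ (a a' c : ℤ), c ∣ a → c ∣ a' → a / c = a' / c → a = a' := by
        intro a a' c ha ha' he
        rw [← Int.mul_ediv_cancel' ha, ← Int.mul_ediv_cancel' ha', he]
      exact Prod.ext (canc _ _ _ d1 d1' e1) (Prod.ext (canc _ _ _ d2 d2' e2)
        (Prod.ext (canc _ _ _ d3 d3' e3) (Prod.ext (canc _ _ _ d4 d4' e4)
        (Prod.ext (canc _ _ _ d5 d5' e5) (canc _ _ _ d6 d6' e6)))))
    have hJ : ∀ u ∈ F.image (divMap bb),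
        JCond R' Q' H' δ u.1 u.2.1 u.2.2.1 u.2.2.2.1 u.2.2.2.2.1 u.2.2.2.2.2 := by
      intro u hu
      obtain ⟨p, hp, rfl⟩ := Finset.mem_image.mp hu
      rw [hF, Finset.mem_filter] at hp
      obtain ⟨hc, hd, _⟩ := hT p hp.1
      have hgp : gcdPair p = bb := hp.2
      have key := JCond_div hc hd
      have hgp1 : Int.gcd (Int.gcd p.1 p.2.2.2.1) p.2.2.2.2.1 = bb.1 := congrArg Prod.fst hgp
      have hgp2 : Int.gcd (Int.gcd p.2.2.2.2.2 p.2.1) p.2.2.1 = bb.2 := congrArg Prod.snd hgp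
      rw [hgp1, hgp2] at key
      simp only [divMap]
      exact key
    have hL7 := lemma7 hR'1 hQ'1 hRH' hδ hη hCη1 hCη (F.image (divMap bb)) hJ
    rw [Finset.card_image_of_injOn hinj] at hL7
    refine hL7.trans ?_
    -- compare the bound for `(R', Q', H')` with `M / (j² k)`
    have hj0 : (0 : ℝ) < bb.1 := by linarith
    have hk0 : (0 : ℝ) < bb.2 := by linarith
    have hH'le : H' ≤ H := by rw [hH']; exact div_le_self hH.le hj1
    have hQ'le : Q' ≤ Q := by rw [hQ']; exact div_le_self hQ0.le hk1
    have hQ'0 : 0 < Q' := by rw [hQ']; positivity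
    have h1 : (4 * H' * Q') ^ η ≤ (4 * H * Q) ^ η := by
      apply Real.rpow_le_rpow (by rw [hH']; positivity) _ hη.le
      have : 0 ≤ H' := by rw [hH']; positivity
      nlinarith
    have h2 : R' * H' * Q' = R * H * Q * (1 / ((bb.1 : ℝ) ^ 2 * bb.2)) := by
      rw [hR', hH', hQ']; field_simp
    have h3 : 1 + Q' * δ ≤ 1 + Q * δ := by nlinarith
    have h4 : 1 + Real.log (9 * Q' / 2) ≤ ℓ := by
      rw [hℓ]
      have := Real.log_le_log (by positivity : 0 < 9 * Q' / 2) (by linarith : 9 * Q' / 2 ≤ 9 * Q / 2)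
      linarith
    have h4' : 0 ≤ 1 + Real.log (9 * Q' / 2) := by linarith [one_le_one_add_log hQ'1]
    have hC0 : 0 ≤ Cη := by linarith
    calc 20800 * (Cη * (4 * H' * Q') ^ η) * (R' * H' * Q') * (1 + Q' * δ) * (1 + Real.log (9 * Q' / 2))
        ≤ 20800 * (Cη * (4 * H * Q) ^ η) * (R' * H' * Q') * (1 + Q * δ) * ℓ := by
          have hRHQ' : 0 ≤ R' * H' * Q' := by rw [hR', hH', hQ']; positivity
          gcongr
      _ = M * (1 / ((bb.1 : ℝ) ^ 2 * bb.2)) := by rw [h2, hM, hW]; ring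
  -- sum over the fibers
  have hsum : (T.card : ℝ) ≤ ∑ bb ∈ B, M * (1 / ((bb.1 : ℝ) ^ 2 * bb.2)) := by
    rw [Finset.card_eq_sum_card_fiberwise hGB]
    push_cast
    exact Finset.sum_le_sum hfib
  refine hsum.trans ?_
  rw [← Finset.mul_sum, hBdef, Finset.sum_product]
  have hprod : ∑ j ∈ Finset.Icc 1 ⌈R⌉₊, ∑ k ∈ Finset.Icc 1 ⌊Q⌋₊, (1 : ℝ) / ((j : ℝ) ^ 2 * k) =
      (∑ j ∈ Finset.Icc 1 ⌈R⌉₊, (1 : ℝ) / (j : ℝ) ^ 2) * ∑ k ∈ Finset.Icc 1 ⌊Q⌋₊, (1 : ℝ) / k := by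
    rw [Finset.sum_mul_sum]
    refine Finset.sum_congr rfl fun j _ => Finset.sum_congr rfl fun k _ => ?_
    rw [one_div_mul_one_div]
  rw [hprod]
  have hJ1 : 1 ≤ ⌈R⌉₊ := Nat.ceil_pos.mpr (by linarith)
  have hK1 : 1 ≤ ⌊Q⌋₊ := Nat.le_floor (by simpa using hQ)
  have hS1 : ∑ j ∈ Finset.Icc 1 ⌈R⌉₊, (1 : ℝ) / (j : ℝ) ^ 2 ≤ 2 := by
    have := sum_inv_sq_le hJ1
    have : (0 : ℝ) ≤ 1 / ⌈R⌉₊ := by positivity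
    linarith
  have hS2 : ∑ k ∈ Finset.Icc 1 ⌊Q⌋₊, (1 : ℝ) / k ≤ 1 + Real.log Q := by
    have h1 := harmonic_Icc_le hK1
    have h2 : Real.log (⌊Q⌋₊ : ℝ) ≤ Real.log Q :=
      Real.log_le_log (by exact_mod_cast hK1) (Nat.floor_le hQ0.le)
    linarith
  have hS1n : 0 ≤ ∑ j ∈ Finset.Icc 1 ⌈R⌉₊, (1 : ℝ) / (j : ℝ) ^ 2 :=
    Finset.sum_nonneg fun j _ => by positivity
  have hS2n : 0 ≤ ∑ k ∈ Finset.Icc 1 ⌊Q⌋₊, (1 : ℝ) / k :=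
    Finset.sum_nonneg fun k _ => by positivity
  have hlogQ : 0 ≤ 1 + Real.log Q := by
    have := Real.log_nonneg hQ; linarith
  calc M * ((∑ j ∈ Finset.Icc 1 ⌈R⌉₊, (1 : ℝ) / (j : ℝ) ^ 2) * ∑ k ∈ Finset.Icc 1 ⌊Q⌋₊, (1 : ℝ) / k)
      ≤ M * (2 * (1 + Real.log Q)) := by
        apply mul_le_mul_of_nonneg_left _ hM0
        exact mul_le_mul hS1 hS2 hS2n (by norm_num)
    _ = 41600 * (Cη * (4 * H * Q) ^ η) * (R * H * Q) * (1 + Q * δ) *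
          (1 + Real.log (9 * Q / 2)) * (1 + Real.log Q) := by rw [hM, hW, hℓ]; ring

/-! ### Lemma 6 and Theorem 2 -/

/-- **[RS] Lemma 6 (with Lemma 7 inserted).** For sextuples satisfying (3·4), (3·8) (the image of
`𝒩` under `d = n₁ - n₂`): `# ≤ 43000 C_η (4HQ)^η RHQ (1 + Qδ)(1 + log(9Q/2))²`, the three classes
being `d = 0` (divisor bound), `gcd(d,q₁,q₂) > Q`, and `gcd(d,q₁,q₂) ≤ Q` (Lemma 7 after division
by the gcds). [cite: RobertSargos2002, Lemma 6, (3.7), (3.10), (3.11)] -/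
theorem lemma6 {R Q H δ η Cη : ℝ} (hR : 1 ≤ R) (hQ : 1 ≤ Q) (hRH : 2 * R ≤ H) (hδ : 0 < δ)
    (hη : 0 < η) (hCη1 : 1 ≤ Cη)
    (hCη : ∀ n : ℕ, n ≠ 0 → ((Nat.divisors n).card : ℝ) ≤ Cη * (n : ℝ) ^ η)
    (T : Finset (ℤ × ℤ × ℤ × ℤ × ℤ × ℤ))
    (hT : ∀ t ∈ T, KCond R Q H δ t.1 t.2.1 t.2.2.1 t.2.2.2.1 t.2.2.2.2.1 t.2.2.2.2.2) :
    (T.card : ℝ) ≤ 43000 * (Cη * (4 * H * Q) ^ η) * (R * H * Q) * (1 + Q * δ) *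
      (1 + Real.log (9 * Q / 2)) ^ 2 := by
  classical
  have hH : 0 < H := by linarith
  have hQ0 : 0 < Q := by linarith
  have hR0 : 0 < R := by linarith
  set W : ℝ := Cη * (4 * H * Q) ^ η with hW
  have hW1 : 1 ≤ W := by
    have h1 : (1 : ℝ) ≤ (4 * H * Q) ^ η := Real.one_le_rpow (by nlinarith) hη.le
    nlinarith
  set ℓ : ℝ := 1 + Real.log (9 * Q / 2) with hℓ
  have hℓ1 : 1 ≤ ℓ := one_le_one_add_log hQ
  have hℓQ : 1 + Real.log Q ≤ ℓ := by
    rw [hℓ]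
    have := Real.log_le_log hQ0 (by linarith : Q ≤ 9 * Q / 2)
    linarith
  set P : ℝ := R * H * Q with hP
  have hP0 : 0 < P := by positivity
  have hX0 : 0 ≤ Q * δ := by positivity
  -- the three classes
  set T₀ := T.filter fun t => t.2.2.2.2.2 = 0 with hT₀
  set T₁ := T.filter fun t => t.2.2.2.2.2 ≠ 0 ∧
    Q < (Int.gcd (Int.gcd t.2.2.2.2.2 t.2.1) t.2.2.1 : ℝ) with hT₁
  set T₂ := T.filter fun t => t.2.2.2.2.2 ≠ 0 ∧
    (Int.gcd (Int.gcd t.2.2.2.2.2 t.2.1) t.2.2.1 : ℝ) ≤ Q with hT₂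
  have hsub : T ⊆ T₀ ∪ (T₁ ∪ T₂) := by
    intro t ht
    simp only [Finset.mem_union, hT₀, hT₁, hT₂, Finset.mem_filter]
    by_cases h0 : t.2.2.2.2.2 = 0
    · exact Or.inl ⟨ht, h0⟩
    · rcases lt_or_ge Q (Int.gcd (Int.gcd t.2.2.2.2.2 t.2.1) t.2.2.1 : ℝ) with h | h
      · exact Or.inr (Or.inl ⟨ht, h0, h⟩)
      · exact Or.inr (Or.inr ⟨ht, h0, h⟩)
  have hcard : T.card ≤ T₀.card + (T₁.card + T₂.card) :=
    (Finset.card_le_card hsub).trans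
      ((Finset.card_union_le _ _).trans (Nat.add_le_add_left (Finset.card_union_le _ _) _))
  have h0 := card_le_d_zero hR hQ hRH hη hCη T₀ fun t ht => by
    rw [hT₀, Finset.mem_filter] at ht; exact ⟨hT t ht.1, ht.2⟩
  have h1 := card_le_gcd_large hR hQ hRH hδ T₁ fun t ht => by
    rw [hT₁, Finset.mem_filter] at ht; exact ⟨hT t ht.1, ht.2.1, ht.2.2⟩
  have h2 := card_le_gcd_small hR hQ hRH hδ hη hCη1 hCη T₂ fun t ht => by
    rw [hT₂, Finset.mem_filter] at ht; exact ⟨hT t ht.1, ht.2.1, ht.2.2⟩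
  -- inflate each bound to a multiple of `W P (1 + Qδ) ℓ²`
  have hPX : P ≤ P * (1 + Q * δ) := le_mul_of_one_le_right hP0.le (by linarith)
  have hb0 : (T₀.card : ℝ) ≤ 120 * W * P * (1 + Q * δ) * ℓ ^ 2 := by
    refine h0.trans ?_
    have e : 120 * Cη * (4 * H * Q) ^ η * (R * H * Q) = 120 * W * P := by simp only [hW, hP]; ring
    rw [e]
    have : 120 * W * P * 1 * 1 ≤ 120 * W * P * (1 + Q * δ) * ℓ ^ 2 := by
      gcongr
      · linarith
      · nlinarith
    linarith
  have hb1 : (T₁.card : ℝ) ≤ 1260 * W * P * (1 + Q * δ) * ℓ ^ 2 := by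
    refine h1.trans ?_
    have h3 : 1 + δ ≤ 1 + Q * δ := by nlinarith
    have : 1260 * (R * H * Q) * (1 + δ) * 1 * 1 ≤ 1260 * P * (1 + Q * δ) * W * ℓ ^ 2 := by
      simp only [hP]; gcongr; nlinarith
    linarith
  have hb2 : (T₂.card : ℝ) ≤ 41600 * W * P * (1 + Q * δ) * ℓ ^ 2 := by
    refine h2.trans ?_
    have e : 41600 * (Cη * (4 * H * Q) ^ η) * (R * H * Q) * (1 + Q * δ) * (1 + Real.log (9 * Q / 2)) *
        (1 + Real.log Q) = 41600 * W * P * (1 + Q * δ) * ℓ * (1 + Real.log Q) := by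
      simp only [hW, hP, hℓ]
    rw [e]
    have hlogQ : 0 ≤ 1 + Real.log Q := by have := Real.log_nonneg hQ; linarith
    have : 41600 * W * P * (1 + Q * δ) * ℓ * (1 + Real.log Q) ≤
        41600 * W * P * (1 + Q * δ) * ℓ * ℓ := by
      apply mul_le_mul_of_nonneg_left hℓQ; positivity
    linarith
  have : (T.card : ℝ) ≤ T₀.card + (T₁.card + T₂.card) := by exact_mod_cast hcard
  have e : 43000 * (Cη * (4 * H * Q) ^ η) * (R * H * Q) * (1 + Q * δ) * (1 + Real.log (9 * Q / 2)) ^ 2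
      = 43000 * W * P * (1 + Q * δ) * ℓ ^ 2 := by simp only [hW, hP, hℓ]
  rw [e]
  have hpos : 0 ≤ W * P * (1 + Q * δ) * ℓ ^ 2 := by positivity
  nlinarith

/-- **Robert–Sargos 2002, Theorem 2.** Let `R, Q, N ≥ 1`, `H ≥ 2R` be real and `δ > 0`. The
number `𝒩(R,Q,H,N,δ)` of integer points `(r, q₁, q₂, h₁, h₂, n₁, n₂)` with `0 < |r| < R`,
`Q ≤ |qᵢ| < 2Q`, `H ≤ hᵢ < 2H`, `1 ≤ nᵢ ≤ N`, `q₁q₂ > 0` (3·1) satisfying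
`rn₁ + h₁q₁ = rn₂ + h₂q₂`, `|rn₁² + 2h₁q₁n₁ + h₁q₁² - (rn₂² + 2h₂q₂n₂ + h₂q₂²)| ≤ δHQ²` (3·2)
satisfies `𝒩(R,H,Q,N,δ) ≪_ε (RNHQ)^{1+ε}(1 + δQ)` (3·3): for every `ε > 0` there is `C` with
`#S ≤ C (RNHQ)^{1+ε}(1 + δQ)` for every finite set `S` of such septuples.
[cite: RobertSargos2002, Theorem 2] -/
theorem theorem2 {ε : ℝ} (hε : 0 < ε) : ∃ C : ℝ, 0 < C ∧
    ∀ (R Q H N δ : ℝ), 1 ≤ R → 1 ≤ Q → 1 ≤ N → 2 * R ≤ H → 0 < δ →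
    ∀ S : Finset (ℤ × ℤ × ℤ × ℤ × ℤ × ℤ × ℤ),
      (∀ p ∈ S, NCond R Q H N δ p.1 p.2.1 p.2.2.1 p.2.2.2.1 p.2.2.2.2.1 p.2.2.2.2.2.1
        p.2.2.2.2.2.2) →
      (S.card : ℝ) ≤ C * (R * N * H * Q) ^ (1 + ε) * (1 + δ * Q) := by
  have hε3 : 0 < ε / 3 := by positivity
  obtain ⟨Cη, hCη1, hCη⟩ :=
    Literature.NumberTheory.Sieve.exists_card_divisors_le_mul_rpow hε3
  refine ⟨43000 * Cη * (4 : ℝ) ^ (ε / 3) * (5 + 3 / ε) ^ 2, by positivity, ?_⟩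
  intro R Q H N δ hR hQ hN hRH hδ S hS
  classical
  have hH : 0 < H := by linarith
  have hQ0 : 0 < Q := by linarith
  have hR0 : 0 < R := by linarith
  have hN0 : 0 < N := by linarith
  -- Step 1: project to sextuples (Lemma 6, first step) and apply Lemma 6
  have h1 := card_le_N_mul_card_image hN S hS
  set T := S.image psi with hTdef
  have hT : ∀ t ∈ T, KCond R Q H δ t.1 t.2.1 t.2.2.1 t.2.2.2.1 t.2.2.2.2.1 t.2.2.2.2.2 := by
    intro t ht
    obtain ⟨p, hp, rfl⟩ := Finset.mem_image.mp ht
    exact (hS p hp).toKCond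
  have h2 := lemma6 hR hQ hRH hδ hε3 hCη1 hCη T hT
  -- Step 2: the factors
  set P : ℝ := R * N * H * Q with hP
  have hP0 : 0 < P := by positivity
  have hHQP : H * Q ≤ P := by
    have : 1 ≤ R * N := by nlinarith
    have hHQ : 0 ≤ H * Q := by positivity
    calc H * Q = 1 * (H * Q) := by ring
      _ ≤ (R * N) * (H * Q) := mul_le_mul_of_nonneg_right this hHQ
      _ = P := by rw [hP]; ring
  have hQP : Q ≤ P := by
    have : 1 ≤ R * N * H := by nlinarith
    calc Q = 1 * Q := by ring
      _ ≤ (R * N * H) * Q := mul_le_mul_of_nonneg_right this hQ0.le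
  have hW : Cη * (4 * H * Q) ^ (ε / 3) ≤ Cη * (4 : ℝ) ^ (ε / 3) * P ^ (ε / 3) := by
    rw [show (4 : ℝ) * H * Q = 4 * (H * Q) by ring, Real.mul_rpow (by norm_num) (by positivity),
      mul_assoc]
    apply mul_le_mul_of_nonneg_left _ (by linarith)
    apply mul_le_mul_of_nonneg_left _ (by positivity)
    exact Real.rpow_le_rpow (by positivity) hHQP hε3.le
  have hℓ : 1 + Real.log (9 * Q / 2) ≤ (5 + 3 / ε) * Q ^ (ε / 3) := by
    have h3 : Real.log (9 * Q / 2) = Real.log (9 / 2) + Real.log Q := by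
      rw [show 9 * Q / 2 = 9 / 2 * Q by ring, Real.log_mul (by norm_num) hQ0.ne']
    have h4 : Real.log (9 / 2 : ℝ) ≤ 9 / 2 - 1 := Real.log_le_sub_one_of_pos (by norm_num)
    have h5 : Real.log Q ≤ Q ^ (ε / 3) / (ε / 3) := Real.log_le_rpow_div hQ0.le hε3
    have h6 : (1 : ℝ) ≤ Q ^ (ε / 3) := Real.one_le_rpow hQ hε3.le
    rw [h3]
    have h7 : Q ^ (ε / 3) / (ε / 3) = 3 / ε * Q ^ (ε / 3) := by field_simp
    rw [h7] at h5
    nlinarith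
  have hℓ0 : 0 ≤ 1 + Real.log (9 * Q / 2) := by linarith [one_le_one_add_log hQ]
  have hℓ2 : (1 + Real.log (9 * Q / 2)) ^ 2 ≤ (5 + 3 / ε) ^ 2 * P ^ (2 * ε / 3) := by
    have h3 : (1 + Real.log (9 * Q / 2)) ^ 2 ≤ ((5 + 3 / ε) * Q ^ (ε / 3)) ^ 2 :=
      pow_le_pow_left₀ hℓ0 hℓ 2
    refine h3.trans ?_
    rw [mul_pow]
    apply mul_le_mul_of_nonneg_left _ (by positivity)
    rw [← Real.rpow_natCast, ← Real.rpow_mul hQ0.le]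
    rw [show ε / 3 * ((2 : ℕ) : ℝ) = 2 * ε / 3 by push_cast; ring]
    exact Real.rpow_le_rpow hQ0.le hQP (by positivity)
  -- Step 3: combine
  have h3 : (S.card : ℝ) ≤ 43000 * (Cη * (4 * H * Q) ^ (ε / 3)) * (R * H * Q) * (1 + Q * δ) *
      (1 + Real.log (9 * Q / 2)) ^ 2 * N := by
    refine h1.trans ?_
    exact mul_le_mul_of_nonneg_right h2 hN0.le
  refine h3.trans ?_
  have hX0 : 0 ≤ 1 + Q * δ := by positivity
  have e1 : 43000 * (Cη * (4 * H * Q) ^ (ε / 3)) * (R * H * Q) * (1 + Q * δ) *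
      (1 + Real.log (9 * Q / 2)) ^ 2 * N =
      43000 * ((Cη * (4 * H * Q) ^ (ε / 3)) * (1 + Real.log (9 * Q / 2)) ^ 2) * P * (1 + Q * δ) := by
    rw [hP]; ring
  rw [e1]
  have h4 : (Cη * (4 * H * Q) ^ (ε / 3)) * (1 + Real.log (9 * Q / 2)) ^ 2 ≤
      (Cη * (4 : ℝ) ^ (ε / 3) * P ^ (ε / 3)) * ((5 + 3 / ε) ^ 2 * P ^ (2 * ε / 3)) :=
    mul_le_mul hW hℓ2 (by positivity) (by positivity)
  have e2 : P ^ (1 + ε) = P ^ (ε / 3) * P ^ (2 * ε / 3) * P := by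
    rw [Real.rpow_add hP0, Real.rpow_one, show ε = ε / 3 + 2 * ε / 3 by ring,
      Real.rpow_add hP0]
    ring_nf
  calc 43000 * ((Cη * (4 * H * Q) ^ (ε / 3)) * (1 + Real.log (9 * Q / 2)) ^ 2) * P * (1 + Q * δ)
      ≤ 43000 * ((Cη * (4 : ℝ) ^ (ε / 3) * P ^ (ε / 3)) * ((5 + 3 / ε) ^ 2 * P ^ (2 * ε / 3))) *
          P * (1 + Q * δ) := by gcongr
    _ = 43000 * Cη * (4 : ℝ) ^ (ε / 3) * (5 + 3 / ε) ^ 2 * (P ^ (ε / 3) * P ^ (2 * ε / 3) * P) *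
          (1 + δ * Q) := by ring
    _ = 43000 * Cη * (4 : ℝ) ^ (ε / 3) * (5 + 3 / ε) ^ 2 * (R * N * H * Q) ^ (1 + ε) *
          (1 + δ * Q) := by rw [← e2]

end RobertSargos
end Literature.NumberTheory.LFunctions

end
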